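import Literature.Probability.LatticeModels.ModifiedSimonInequality
import Literature.Probability.LatticeModels.GKSInequalities
import Literature.Probability.LatticeModels.SharpnessSubcritical
import HarnessLib

/-!
# Random currents with edge-dependent couplings, a ghost vertex and a magnetic field

Trunk G02 (T-STATMECH), topic `Probability/LatticeModels`, namespace `Literature.StatMech`. Sequel of
`ModifiedSimonInequality` (currents `n : ℰ_Λ → ℕ` on the edges of a finite volume of a locally
finite graph, `ℝ≥0∞`-valued sums, the switching lemma at coupling `β` on every edge). This file
supplies the tools of Duminil-Copin–Tassion 2016, §2.3 ("Random-current representation",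
arXiv:1502.03050 numbering) needed for the proof of their Lemma 2.6 (the mean-field
differential inequality, *with* magnetic field):

**Part I — currents with edge-dependent couplings `θ_e ≥ 0`** on the edges `ℰ_Λ` of a finite
volume `Λ` of a locally finite graph `G` (Duminil-Copin–Tassion 2016, Def. 2.4 and the display
`w(n) = ∏ (βJ_{x,y})^{n_{x,y}} / n_{x,y}!`): weights `gweight θ n = ∏_e θ_e^{n_e}/n_e!`
(`ℝ≥0∞`), generating sums `gcurrentZ θ E' A = ∑_{n ⊆ E', ∂n = A} w_θ(n)`, their evaluation by
parity classes `gcurrentZ θ E' A = (∏_{e ∈ E'} cosh θ_e) ∑_{F ⊆ E', ∂F = A} ∏_{e ∈ F} tanh θ_e`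
(`gcurrentZ_eq_ofReal_ghteSum`), the resummation of pairs over their sum and the **switching
lemma with an arbitrary function `F(n₁ + n₂)`** (ibid., Lemma 2.5 = Aizenman 1982;
`tsum_switching_theta`), restriction of currents to edge sets and the factorisation of sums over
currents with no charged edge across a cut (`tsum_eq_tsum_prod_of_csupp_union`), and the cluster
complement `𝒮_b(m)` of a vertex ("the set of vertices not connected to `b`", ibid., proof of
Lemma 2.6) with its characterisation across a cut and the parity of sources inside a cluster.

**Part II — the ghost vertex.** For a finite volume `Λ` of `G` the graph `ghostGraph G Λ` on
`Option V` joins the ghost `g = none` to every vertex of `Λ` (ibid., §2.3: "We consider an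
additional vertex `g` … and define `J_{x,g} = h/β`"); with the couplings `θ = β` on the edges of
`G` and `θ = βh` on the ghost edges (the tree's field enters the Hamiltonian as `βh`), the
high-temperature expansion with field gives **the random-current representation (2.2)**:
for `S ⊆ Λ` and `A ⊆ S`,
`⟨σ_A⟩^∅_{S;β,h} = Z_{ℰ⁺_S}(A*) / Z_{ℰ⁺_S}(∅)`, `A* = A` (resp. `A ∪ {g}`) for `|A|` even (resp.
odd) (`isingCorr_free_eq_gcurrentZ_div`), where `ℰ⁺_S` consists of the edges of `G` inside `S`
and the ghost edges at `S`; and at zero field `⟨σ_A⟩^∅_{S;β,0} = Z_{ℰ_S}(A) / Z_{ℰ_S}(∅)` with the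
currents on the edges of `G` inside `S` only (`isingCorr_free_zero_eq_gcurrentZ_div`).

All sums over currents are unconditional sums in `ℝ≥0∞`; finiteness comes from the
high-temperature evaluation. Indicators are the classical `ind` of `ModifiedSimonInequality`.

## References

* H. Duminil-Copin, V. Tassion, CMP 343 (2016) 725, §2.3 (Def. 2.4, eq. (2.2), Lemma 2.5)
  (arXiv:1502.03050 numbering) [DuminilCopinTassionCMP2016].
* H. Duminil-Copin, *Random currents expansion of the Ising model*, arXiv:1607.06933, §2.1,
  §2.2.1, §3 (Lemma 3.1, Remark 3.4) [DuminilCopinECM2018].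
* M. Aizenman, Comm. Math. Phys. 86 (1982) 1 (switching lemma, ghost spin).
* R. B. Griffiths, C. A. Hurst, S. Sherman, J. Math. Phys. 11 (1970) 790.
-/

noncomputable section

open Finset MeasureTheory
open scoped symmDiff ENNReal

namespace Literature.Probability.LatticeModels

variable {V : Type*} [DecidableEq V]

/-! ## Part I. Currents with edge-dependent couplings -/

section Theta

variable {G : SimpleGraph V} [G.LocallyFinite] {Λ : Finset V}

/-! ### Weights and generating sums -/

variable (G Λ) in
/-- The weight `w_θ(n) = ∏_e θ_e^{n_e} / n_e!` of a current with edge-dependent couplings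
`θ_e` (Duminil-Copin–Tassion 2016, §2.3: `w(n) = ∏ (βJ_{x,y})^{n_{x,y}}/n_{x,y}!`), in `ℝ≥0∞`. [cite: DuminilCopinTassionCMP2016, §2.3, Def. 2.4 and the definition of w(n) (arXiv:1502.03050 numbering)] -/
def gweight (θ : Sym2 V → ℝ) (n : edgesIn G Λ → ℕ) : ℝ≥0∞ :=
  ∏ e : edgesIn G Λ, edgeWeight (θ e) (n e)

variable (G Λ) in
/-- The generating sum `Z_{E'}(A) = ∑_{n ⊆ E', ∂n = A} w_θ(n)` of currents supported in `E'`
with sources `A` (Duminil-Copin–Tassion 2016, §2.3, "`∑_{∂n = A}` for the sum running on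
currents on `S` with sources `A`"). [cite: DuminilCopinTassionCMP2016, §2.3, eq. (2.2) (arXiv:1502.03050 numbering)] -/
def gcurrentZ (θ : Sym2 V → ℝ) (E' : Finset (Sym2 V)) (A : Finset V) : ℝ≥0∞ :=
  ∑' n : edgesIn G Λ → ℕ, ind (csources G Λ n = A ∧ CSupp G Λ E' n) * gweight G Λ θ n

/-- The zero current has weight one. [folklore] -/
@[simp] theorem gweight_zero (θ : Sym2 V → ℝ) : gweight G Λ θ (0 : edgesIn G Λ → ℕ) = 1 := by
  simp [gweight]

/-- Changing the multiplicity of one edge `e₀` from `0` to `k` multiplies the weight by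
`θ_{e₀}ᵏ/k!`. [folklore] -/
theorem gweight_update {n : edgesIn G Λ → ℕ} {e₀ : edgesIn G Λ} (h : n e₀ = 0) (θ : Sym2 V → ℝ)
    (k : ℕ) : gweight G Λ θ (Function.update n e₀ k) = edgeWeight (θ e₀) k * gweight G Λ θ n := by
  unfold gweight
  rw [← mul_prod_erase _ _ (mem_univ e₀),
    ← mul_prod_erase univ (fun e : edgesIn G Λ => edgeWeight (θ e) (n e)) (mem_univ e₀),
    Function.update_self, h, edgeWeight_zero, one_mul]
  congr 1
  exact prod_congr rfl fun e he => by rw [Function.update_of_ne (ne_of_mem_erase he)]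

/-- `w_θ(n) ≠ ∞`. [folklore] -/
theorem gweight_ne_top (θ : Sym2 V → ℝ) (n : edgesIn G Λ → ℕ) : gweight G Λ θ n ≠ ∞ := by
  unfold gweight edgeWeight
  exact ENNReal.prod_ne_top fun _ _ => ENNReal.ofReal_ne_top

/-- The weight of a current charging an edge of zero coupling vanishes. [folklore] -/
theorem gweight_eq_zero_of_apply_ne_zero {θ : Sym2 V → ℝ} {n : edgesIn G Λ → ℕ} {e : edgesIn G Λ}
    (hθ : θ e = 0) (hn : n e ≠ 0) : gweight G Λ θ n = 0 := by
  unfold gweight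
  apply prod_eq_zero (mem_univ e)
  rw [edgeWeight, hθ, zero_pow hn, zero_div, ENNReal.ofReal_zero]

/-- The weight only depends on the couplings of the charged edges. [folklore] -/
theorem gweight_congr {θ θ' : Sym2 V → ℝ} {n : edgesIn G Λ → ℕ}
    (h : ∀ e : edgesIn G Λ, n e ≠ 0 → θ e = θ' e) : gweight G Λ θ n = gweight G Λ θ' n := by
  unfold gweight
  refine prod_congr rfl fun e _ => ?_
  by_cases hn : n e = 0
  · rw [hn, edgeWeight_zero, edgeWeight_zero]
  · rw [h e hn]

/-- `Z_{E'}(A)` only depends on the couplings on `E'`. [folklore] -/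
theorem gcurrentZ_congr {θ θ' : Sym2 V → ℝ} {E' : Finset (Sym2 V)}
    (h : ∀ e ∈ E', θ e = θ' e) (A : Finset V) :
    gcurrentZ G Λ θ E' A = gcurrentZ G Λ θ' E' A := by
  refine tsum_congr fun n => ?_
  by_cases hs : CSupp G Λ E' n
  · rw [gweight_congr fun e he => h e (hs e he)]
  · rw [ind_of_false fun h' => hs h'.2, zero_mul, zero_mul]

/-- Restricting the support to the edges of nonzero coupling does not change `Z_{E'}(A)`:
if `θ = 0` on `E' ∖ E''` and `E'' ⊆ E'` then `Z_{E'}(A) = Z_{E''}(A)`. [folklore] -/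
theorem gcurrentZ_eq_of_zero_off {θ : Sym2 V → ℝ} {E' E'' : Finset (Sym2 V)} (hsub : E'' ⊆ E')
    (h0 : ∀ e ∈ E', e ∉ E'' → θ e = 0) (A : Finset V) :
    gcurrentZ G Λ θ E' A = gcurrentZ G Λ θ E'' A := by
  refine tsum_congr fun n => ?_
  by_cases hs'' : CSupp G Λ E'' n
  · have hs' : CSupp G Λ E' n := fun e he => hsub (hs'' e he)
    congr 1
    exact ind_congr ⟨fun h => ⟨h.1, hs''⟩, fun h => ⟨h.1, hs'⟩⟩
  · rw [ind_of_false (show ¬(csources G Λ n = A ∧ CSupp G Λ E'' n) from fun h => hs'' h.2),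
      zero_mul]
    by_cases hs' : CSupp G Λ E' n
    · obtain ⟨e, hne, he⟩ : ∃ e, n e ≠ 0 ∧ (e : Sym2 V) ∉ E'' := by
        by_contra hcon
        push Not at hcon
        exact hs'' fun e hne => hcon e hne
      rw [gweight_eq_zero_of_apply_ne_zero (h0 _ (hs' e hne) he) hne, mul_zero]
    · rw [ind_of_false (show ¬(csources G Λ n = A ∧ CSupp G Λ E' n) from fun h => hs' h.2),
        zero_mul]

/-! ### Parity classes: `Z_{E'}(A) = (∏_{E'} cosh θ_e) ∑_{F ⊆ E', ∂F = A} ∏_{F} tanh θ_e` -/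

variable (G Λ) in
/-- The per-edge factor of the parity-class decomposition. [folklore] -/
def gParityFactor (θ : Sym2 V → ℝ) (E' : Finset (Sym2 V)) (P : Finset (edgesIn G Λ))
    (e : edgesIn G Λ) (k : ℕ) : ℝ≥0∞ :=
  ind ((Odd k ↔ e ∈ P) ∧ (k ≠ 0 → (e : Sym2 V) ∈ E')) * edgeWeight (θ e) k

variable (G Λ) in
/-- Decomposition of a current summand according to its parity class `P = {e | n_e odd}`. [folklore] -/
theorem ind_mul_gweight_eq_sum_gParityFactor (θ : Sym2 V → ℝ) (E' : Finset (Sym2 V))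
    (A : Finset V) (n : edgesIn G Λ → ℕ) :
    ind (csources G Λ n = A ∧ CSupp G Λ E' n) * gweight G Λ θ n =
      ∑ P : Finset (edgesIn G Λ),
        ind (oddVerts Λ (P.map (Function.Embedding.subtype _)) = A) *
          ∏ e, gParityFactor G Λ θ E' P e (n e) := by
  set P₀ : Finset (edgesIn G Λ) := univ.filter fun e => Odd (n e) with hP₀
  rw [Finset.sum_eq_single P₀]
  · have hprod : ∏ e, gParityFactor G Λ θ E' P₀ e (n e) = ind (CSupp G Λ E' n) * gweight G Λ θ n := by
      simp only [gParityFactor]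
      rw [prod_mul_distrib, prod_ind]
      congr 1
      refine ind_congr ⟨fun h e he => (h e (mem_univ e)).2 he, fun h e _ => ⟨?_, h e⟩⟩
      simp [hP₀]
    have hsrc : oddVerts Λ (P₀.map (Function.Embedding.subtype _)) = csources G Λ n := by
      rw [csources_eq_oddVerts]; rfl
    rw [hprod, hsrc, ← mul_assoc, ← ind_and]
  · intro P _ hP
    have : ∃ e, ¬(Odd (n e) ↔ e ∈ P) := by
      by_contra hcon
      push Not at hcon
      apply hP
      ext e
      rw [hP₀, mem_filter]
      simp [hcon e]
    obtain ⟨e, he⟩ := this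
    rw [prod_eq_zero (mem_univ e), mul_zero]
    simp only [gParityFactor]
    rw [ind_of_false (fun h => he h.1), zero_mul]
  · intro h
    exact absurd (mem_univ P₀) h

variable (G Λ) in
/-- The per-edge sums of the parity-class decomposition (`θ_e ≥ 0`). [folklore] -/
theorem tsum_gParityFactor {θ : Sym2 V → ℝ} (hθ : ∀ e, 0 ≤ θ e) (E' : Finset (Sym2 V))
    (P : Finset (edgesIn G Λ)) (e : edgesIn G Λ) :
    ∑' k, gParityFactor G Λ θ E' P e k =
      if e ∈ P then (if (e : Sym2 V) ∈ E' then ENNReal.ofReal (Real.sinh (θ e)) else 0)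
      else (if (e : Sym2 V) ∈ E' then ENNReal.ofReal (Real.cosh (θ e)) else 1) := by
  simp only [gParityFactor]
  by_cases hP : e ∈ P
  · rw [if_pos hP]
    by_cases hE : (e : Sym2 V) ∈ E'
    · rw [if_pos hE, ← tsum_edgeWeight_odd (hθ e)]
      refine tsum_congr fun k => ?_
      by_cases hk : Odd k
      · rw [if_pos hk, ind_of_true ⟨iff_of_true hk hP, fun _ => hE⟩, one_mul]
      · rw [if_neg hk, ind_of_false (fun h => hk (h.1.2 hP)), zero_mul]
    · rw [if_neg hE]
      refine ENNReal.tsum_eq_zero.2 fun k => ?_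
      rw [ind_of_false, zero_mul]
      rintro ⟨h1, h2⟩
      have hk : Odd k := h1.2 hP
      exact hE (h2 fun h0 => by simp [h0] at hk)
  · rw [if_neg hP]
    by_cases hE : (e : Sym2 V) ∈ E'
    · rw [if_pos hE, ← tsum_edgeWeight_even (hθ e)]
      refine tsum_congr fun k => ?_
      by_cases hk : Even k
      · rw [if_pos hk, ind_of_true ⟨iff_of_false (Nat.not_odd_iff_even.2 hk) hP, fun _ => hE⟩,
          one_mul]
      · rw [if_neg hk, ind_of_false (fun h => hk (Nat.not_odd_iff_even.1 (fun ho => hP (h.1.1 ho)))),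
          zero_mul]
    · rw [if_neg hE, ← edgeWeight_zero (θ e), ← tsum_ind_eq_mul 0 (edgeWeight (θ e))]
      refine tsum_congr fun k => ?_
      congr 1
      refine ind_congr ⟨fun ⟨_, h2⟩ => ?_, fun hk => ?_⟩
      · by_contra hk
        exact hE (h2 hk)
      · subst hk
        exact ⟨iff_of_false (by simp) hP, fun h => absurd rfl h⟩

variable (G Λ) in
/-- Product of the per-edge sums over all edges. [folklore] -/
theorem prod_tsum_gParityFactor {θ : Sym2 V → ℝ} (hθ : ∀ e, 0 ≤ θ e) (E' : Finset (Sym2 V))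
    (P : Finset (edgesIn G Λ)) :
    ∏ e, ∑' k, gParityFactor G Λ θ E' P e k =
      if P ⊆ edgeIdx G Λ E' then
        (∏ e ∈ P, ENNReal.ofReal (Real.sinh (θ e))) *
          ∏ e ∈ edgeIdx G Λ E' \ P, ENNReal.ofReal (Real.cosh (θ e))
      else 0 := by
  simp_rw [tsum_gParityFactor G Λ hθ]
  split_ifs with hsub
  · rw [← prod_filter_mul_prod_filter_not univ (fun e => e ∈ edgeIdx G Λ E')]
    have h1 : (univ.filter fun e => e ∈ edgeIdx G Λ E') = edgeIdx G Λ E' := filter_univ_mem _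
    have h2 : ∏ e ∈ univ.filter (fun e => ¬e ∈ edgeIdx G Λ E'),
        (if e ∈ P then (if (e : Sym2 V) ∈ E' then ENNReal.ofReal (Real.sinh (θ e)) else 0)
          else (if (e : Sym2 V) ∈ E' then ENNReal.ofReal (Real.cosh (θ e)) else 1)) = 1 := by
      refine prod_eq_one fun e he => ?_
      have he' : (e : Sym2 V) ∉ E' := by simpa using he
      have heP : e ∉ P := fun h => he' (mem_edgeIdx.1 (hsub h))
      rw [if_neg heP, if_neg he']
    rw [h2, mul_one, h1]
    have h3 : ∏ e ∈ edgeIdx G Λ E',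
        (if e ∈ P then (if (e : Sym2 V) ∈ E' then ENNReal.ofReal (Real.sinh (θ e)) else 0)
          else (if (e : Sym2 V) ∈ E' then ENNReal.ofReal (Real.cosh (θ e)) else 1)) =
        ∏ e ∈ edgeIdx G Λ E',
          (if e ∈ P then ENNReal.ofReal (Real.sinh (θ e)) else ENNReal.ofReal (Real.cosh (θ e))) := by
      refine prod_congr rfl fun e he => ?_
      rw [if_pos (mem_edgeIdx.1 he), if_pos (mem_edgeIdx.1 he)]
    rw [h3, prod_ite, filter_mem_eq_inter, inter_eq_right.2 hsub, ← sdiff_eq_filter]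
  · obtain ⟨e, heP, he⟩ := not_subset.1 hsub
    have he' : (e : Sym2 V) ∉ E' := fun h => he (mem_edgeIdx.2 h)
    apply prod_eq_zero (mem_univ e)
    rw [if_pos heP, if_neg he']

variable (G Λ) in
/-- **Parity-class evaluation of current sums with edge-dependent couplings**: for `E' ⊆ ℰ_Λ`
and `θ ≥ 0`, `Z_{E'}(A) = ∑_{F ⊆ E', ∂F = A} ∏_{e ∈ F} sinh θ_e ∏_{e ∈ E' ∖ F} cosh θ_e`
(Duminil-Copin 2016, Remark 3.4: a current is a high-temperature graph dressed with even
multiplicities). [cite: DuminilCopinECM2018, §3, Remark 3.4] -/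
theorem gcurrentZ_eq_sum_powerset {θ : Sym2 V → ℝ} (hθ : ∀ e, 0 ≤ θ e) {E' : Finset (Sym2 V)}
    (hE' : E' ⊆ edgesIn G Λ) (A : Finset V) :
    gcurrentZ G Λ θ E' A =
      ∑ F ∈ E'.powerset, ind (oddVerts Λ F = A) *
        ((∏ e ∈ F, ENNReal.ofReal (Real.sinh (θ e))) *
          ∏ e ∈ E' \ F, ENNReal.ofReal (Real.cosh (θ e))) := by
  have step1 : gcurrentZ G Λ θ E' A =
      ∑ P : Finset (edgesIn G Λ), ind (oddVerts Λ (P.map (Function.Embedding.subtype _)) = A) *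
        ∏ e, ∑' k, gParityFactor G Λ θ E' P e k := by
    unfold gcurrentZ
    simp_rw [ind_mul_gweight_eq_sum_gParityFactor G Λ θ E' A]
    rw [Summable.tsum_finsetSum (fun _ _ => ENNReal.summable)]
    refine sum_congr rfl fun P _ => ?_
    rw [ENNReal.tsum_mul_left, tsum_pi_nat_prod]
  rw [step1]
  simp_rw [prod_tsum_gParityFactor G Λ hθ]
  rw [← sum_filter_add_sum_filter_not univ (fun P => P ⊆ edgeIdx G Λ E')]
  have hzero : ∑ P ∈ univ.filter (fun P => ¬P ⊆ edgeIdx G Λ E'),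
      ind (oddVerts Λ (P.map (Function.Embedding.subtype _)) = A) *
        (if P ⊆ edgeIdx G Λ E' then
          (∏ e ∈ P, ENNReal.ofReal (Real.sinh (θ e))) *
            ∏ e ∈ edgeIdx G Λ E' \ P, ENNReal.ofReal (Real.cosh (θ e))
        else 0) = 0 :=
    sum_eq_zero fun P hP => by rw [if_neg (mem_filter.1 hP).2, mul_zero]
  rw [hzero, add_zero]
  refine sum_nbij' (fun P => P.map (Function.Embedding.subtype _))
    (fun F => F.subtype (· ∈ edgesIn G Λ)) ?_ ?_ ?_ ?_ ?_
  · intro P hP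
    rw [mem_powerset]
    intro x hx
    obtain ⟨e, he, rfl⟩ := mem_map.1 hx
    exact mem_edgeIdx.1 ((mem_filter.1 hP).2 he)
  · intro F hF
    rw [mem_filter]
    refine ⟨mem_univ _, fun e he => mem_edgeIdx.2 (mem_powerset.1 hF (mem_subtype.1 he))⟩
  · intro P _
    ext e
    rw [mem_subtype]
    exact mem_map' _
  · intro F hF
    rw [subtype_map, filter_true_of_mem fun x hx => hE' (mem_powerset.1 hF hx)]
  · intro P hP
    have hsub : P ⊆ edgeIdx G Λ E' := (mem_filter.1 hP).2
    rw [if_pos hsub]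
    -- `edgeIdx E' \ P` versus `E' \ P.map val`
    have hset : (edgeIdx G Λ E' \ P).map (Function.Embedding.subtype _) =
        E' \ P.map (Function.Embedding.subtype _) := by
      ext x
      simp only [mem_map, mem_sdiff, mem_edgeIdx, Function.Embedding.coe_subtype]
      constructor
      · rintro ⟨e, ⟨he1, he2⟩, rfl⟩
        exact ⟨he1, fun ⟨e', he', hee'⟩ => he2 (by rwa [← Subtype.ext hee'])⟩
      · rintro ⟨hx1, hx2⟩
        exact ⟨⟨x, hE' hx1⟩, ⟨hx1, fun h => hx2 ⟨_, h, rfl⟩⟩, rfl⟩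
    have h1 : ∏ e ∈ P, ENNReal.ofReal (Real.sinh (θ e)) =
        ∏ x ∈ P.map (Function.Embedding.subtype _), ENNReal.ofReal (Real.sinh (θ x)) := by
      rw [prod_map]; rfl
    have h2 : ∏ e ∈ edgeIdx G Λ E' \ P, ENNReal.ofReal (Real.cosh (θ e)) =
        ∏ x ∈ E' \ P.map (Function.Embedding.subtype _), ENNReal.ofReal (Real.cosh (θ x)) := by
      rw [← hset, prod_map]; rfl
    rw [h1, h2]

variable (Λ) in
/-- The high-temperature generating sum with edge-dependent couplings,
`g_{E'}(A) = ∑_{F ⊆ E', ∂F = A} ∏_{e ∈ F} tanh θ_e` (Duminil-Copin 2016, §2.2.1: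
`x(E) = ∏_{xy ∈ E} tanh(βJ_{xy})`). [cite: DuminilCopinECM2018, §2.2.1 (high-temperature expansion)] -/
def ghteSum (θ : Sym2 V → ℝ) (E' : Finset (Sym2 V)) (A : Finset V) : ℝ :=
  ∑ F ∈ E'.powerset with oddVerts Λ F = A, ∏ e ∈ F, Real.tanh (θ e)

/-- `g_{E'}(A) ≥ 0` for `θ ≥ 0`. [folklore] -/
theorem ghteSum_nonneg {θ : Sym2 V → ℝ} (hθ : ∀ e, 0 ≤ θ e) (E' : Finset (Sym2 V))
    (A : Finset V) : 0 ≤ ghteSum Λ θ E' A :=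
  sum_nonneg fun _ _ => prod_nonneg fun e _ => Literature.Probability.LatticeModels.tanh_nonneg (hθ e)

variable (G Λ) in
/-- **Current sums versus the high-temperature expansion, edge-dependent couplings**: for
`E' ⊆ ℰ_Λ` and `θ ≥ 0`, `Z_{E'}(A) = (∏_{e ∈ E'} cosh θ_e) · g_{E'}(A)` (Duminil-Copin 2016,
Remark 3.4 with §2.2.1). [cite: DuminilCopinECM2018, §3, Remark 3.4] -/
theorem gcurrentZ_eq_ofReal_ghteSum {θ : Sym2 V → ℝ} (hθ : ∀ e, 0 ≤ θ e) {E' : Finset (Sym2 V)}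
    (hE' : E' ⊆ edgesIn G Λ) (A : Finset V) :
    gcurrentZ G Λ θ E' A =
      ENNReal.ofReal ((∏ e ∈ E', Real.cosh (θ e)) * ghteSum Λ θ E' A) := by
  have hcosh : ∀ e, 0 < Real.cosh (θ e) := fun e => Real.cosh_pos _
  have hsinh : ∀ e, 0 ≤ Real.sinh (θ e) := fun e => Real.sinh_nonneg_iff.2 (hθ e)
  have htanh : ∀ e, 0 ≤ Real.tanh (θ e) := fun e => Literature.Probability.LatticeModels.tanh_nonneg (hθ e)
  rw [gcurrentZ_eq_sum_powerset G Λ hθ hE', ghteSum, mul_sum,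
    ENNReal.ofReal_sum_of_nonneg (fun F _ => mul_nonneg (prod_nonneg fun e _ => (hcosh e).le)
      (prod_nonneg fun e _ => htanh e)), sum_filter]
  refine sum_congr rfl fun F hF => ?_
  have hFE : F ⊆ E' := mem_powerset.1 hF
  by_cases h : oddVerts Λ F = A
  · rw [ind_of_true h, one_mul, if_pos h, ← ENNReal.ofReal_prod_of_nonneg (fun e _ => hsinh e),
      ← ENNReal.ofReal_prod_of_nonneg (fun e _ => (hcosh e).le),
      ← ENNReal.ofReal_mul (prod_nonneg fun e _ => hsinh e)]
    congr 1
    rw [← prod_sdiff hFE, mul_comm, mul_assoc, ← prod_mul_distrib]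
    congr 1
    refine prod_congr rfl fun e _ => ?_
    rw [Real.tanh_eq_sinh_div_cosh, mul_div_cancel₀ _ (hcosh e).ne']
  · rw [ind_of_false h, zero_mul, if_neg h]

/-- `Z_{E'}(A) < ∞` for `E' ⊆ ℰ_Λ`, `θ ≥ 0`. [folklore] -/
theorem gcurrentZ_ne_top {θ : Sym2 V → ℝ} (hθ : ∀ e, 0 ≤ θ e) {E' : Finset (Sym2 V)}
    (hE' : E' ⊆ edgesIn G Λ) (A : Finset V) : gcurrentZ G Λ θ E' A ≠ ∞ := by
  rw [gcurrentZ_eq_ofReal_ghteSum G Λ hθ hE']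
  exact ENNReal.ofReal_ne_top

/-- `Z_{E'}(∅) ≥ 1` (the zero current), in particular `Z_{E'}(∅) ≠ 0`. [folklore] -/
theorem one_le_gcurrentZ_empty (θ : Sym2 V → ℝ) (E' : Finset (Sym2 V)) :
    1 ≤ gcurrentZ G Λ θ E' ∅ := by
  unfold gcurrentZ
  refine le_trans ?_ (ENNReal.le_tsum (0 : edgesIn G Λ → ℕ))
  rw [gweight_zero, mul_one, ind_of_true]
  exact ⟨by simp [csources, cdeg], fun e he => absurd rfl he⟩

/-! ### Pairs of currents: resummation over the sum, and the switching lemma with `F(n₁ + n₂)` -/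

/-- `w_θ(n₁ + n₂) C(n₁ + n₂, n₂) = w_θ(n₁) w_θ(n₂)` for `θ ≥ 0`. [folklore] -/
theorem gweight_add_mul_cbinom {θ : Sym2 V → ℝ} (hθ : ∀ e, 0 ≤ θ e) (n₁ n₂ : edgesIn G Λ → ℕ) :
    gweight G Λ θ (n₁ + n₂) * cbinom G Λ (n₁ + n₂) n₂ = gweight G Λ θ n₁ * gweight G Λ θ n₂ := by
  unfold gweight cbinom
  rw [← prod_mul_distrib, ← prod_mul_distrib]
  exact prod_congr rfl fun e _ => edgeWeight_add_mul_choose (hθ e) (n₁ e) (n₂ e)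

variable (G Λ) in
/-- **Resummation of pairs of currents over their sum**, edge-dependent couplings:
`∑_{n₁,n₂} w(n₁) w(n₂) Φ(n₁ + n₂, n₂) = ∑_m w(m) ∑_{n ≤ m} C(m, n) Φ(m, n)`
(Duminil-Copin–Tassion 2016, proof of Lemma 2.5 = Aizenman 1982; Duminil-Copin 2016, proof of
Lemma 3.1). [cite: DuminilCopinECM2018, §3, Lemma 3.1 (switching lemma), proof] -/
theorem tsum_pair_eq_tsum_cbinom_theta {θ : Sym2 V → ℝ} (hθ : ∀ e, 0 ≤ θ e)
    (Φ : (edgesIn G Λ → ℕ) → (edgesIn G Λ → ℕ) → ℝ≥0∞) :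
    ∑' p : (edgesIn G Λ → ℕ) × (edgesIn G Λ → ℕ),
        gweight G Λ θ p.1 * gweight G Λ θ p.2 * Φ (p.1 + p.2) p.2 =
      ∑' m : edgesIn G Λ → ℕ, gweight G Λ θ m * ∑' n, cbinom G Λ m n * Φ m n := by
  set g : (edgesIn G Λ → ℕ) × (edgesIn G Λ → ℕ) → ℝ≥0∞ :=
    fun q => gweight G Λ θ q.1 * cbinom G Λ q.1 q.2 * Φ q.1 q.2 with hg
  set ψ : (edgesIn G Λ → ℕ) × (edgesIn G Λ → ℕ) → (edgesIn G Λ → ℕ) × (edgesIn G Λ → ℕ) :=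
    fun p => (p.1 + p.2, p.2) with hψ
  have hinj : Function.Injective ψ := by
    intro p p' h
    simp only [hψ, Prod.mk.injEq] at h
    obtain ⟨h1, h2⟩ := h
    have : p.1 = p'.1 := by
      rw [h2] at h1
      exact add_right_cancel h1
    exact Prod.ext this h2
  have hsupp : Function.support g ⊆ Set.range ψ := by
    intro q hq
    have hC : cbinom G Λ q.1 q.2 ≠ 0 := by
      intro h0
      exact hq (by simp [hg, h0])
    have hle : q.2 ≤ q.1 := fun e => le_of_cbinom_ne_zero hC e
    refine ⟨(fun e => q.1 e - q.2 e, q.2), ?_⟩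
    simp only [hψ]
    exact Prod.ext (funext fun e => tsub_add_cancel_of_le (hle e)) rfl
  calc ∑' p : (edgesIn G Λ → ℕ) × (edgesIn G Λ → ℕ),
        gweight G Λ θ p.1 * gweight G Λ θ p.2 * Φ (p.1 + p.2) p.2
      = ∑' p : (edgesIn G Λ → ℕ) × (edgesIn G Λ → ℕ), g (ψ p) := by
        refine tsum_congr fun p => ?_
        simp only [hg, hψ]
        rw [gweight_add_mul_cbinom hθ]
    _ = ∑' q, g q := hinj.tsum_eq hsupp
    _ = ∑' (m : edgesIn G Λ → ℕ) (n : edgesIn G Λ → ℕ), g (m, n) := ENNReal.tsum_prod'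
    _ = ∑' m : edgesIn G Λ → ℕ, gweight G Λ θ m * ∑' n, cbinom G Λ m n * Φ m n := by
        refine tsum_congr fun m => ?_
        rw [← ENNReal.tsum_mul_left]
        refine tsum_congr fun n => ?_
        simp only [hg, mul_assoc]

/-- Supports of a multigraph and a sub-current (truncated subtraction):
`m - n ⊆ E' ∧ n ⊆ E'` iff `m ⊆ E' ∧ n ⊆ E'`. [folklore] -/
theorem csupp_tsub_and_iff (m n : edgesIn G Λ → ℕ) (E' : Finset (Sym2 V)) :
    (CSupp G Λ E' (m - n) ∧ CSupp G Λ E' n) ↔ (CSupp G Λ E' m ∧ CSupp G Λ E' n) := by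
  constructor
  · rintro ⟨h1, h2⟩
    refine ⟨fun e he => ?_, h2⟩
    by_cases hn : n e = 0
    · exact h1 e (by simp only [Pi.sub_apply, hn, tsub_zero]; exact he)
    · exact h2 e hn
  · rintro ⟨h1, h2⟩
    refine ⟨fun e he => h1 e fun hm => he ?_, h2⟩
    simp only [Pi.sub_apply, hm, zero_tsub]

variable (G Λ) in
/-- **Resummed form of a pair sum with prescribed sources**:
`∑_{∂n₁ = X, ∂n₂ = Y, n₁,n₂ ⊆ E'} w(n₁)w(n₂) H(n₁ + n₂) = ∑_{m ⊆ E', ∂m = X ∆ Y} w(m) H(m) N_m(E', Y)`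
with the binomially weighted count `N_m(E', Y)` of `ModifiedSimonInequality.switchCount`
(Duminil-Copin 2016, proof of Lemma 3.1: "fix the multigraph `ℳ = n₁ + n₂`"). [cite: DuminilCopinECM2018, §3, Lemma 3.1 (switching lemma), proof] -/
theorem tsum_pair_sources_eq {θ : Sym2 V → ℝ} (hθ : ∀ e, 0 ≤ θ e) (E' : Finset (Sym2 V))
    (X Y : Finset V) (H : (edgesIn G Λ → ℕ) → ℝ≥0∞) :
    ∑' p : (edgesIn G Λ → ℕ) × (edgesIn G Λ → ℕ),
        ind (csources G Λ p.1 = X ∧ CSupp G Λ E' p.1) *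
          ind (csources G Λ p.2 = Y ∧ CSupp G Λ E' p.2) *
            (gweight G Λ θ p.1 * gweight G Λ θ p.2 * H (p.1 + p.2)) =
      ∑' m : edgesIn G Λ → ℕ, gweight G Λ θ m *
        (H m * ind (CSupp G Λ E' m) * (ind (csources G Λ m = X ∆ Y) * switchCount G Λ m E' Y)) := by
  set Φ : (edgesIn G Λ → ℕ) → (edgesIn G Λ → ℕ) → ℝ≥0∞ := fun m n =>
    H m * (ind (csources G Λ (m - n) = X ∧ CSupp G Λ E' (m - n)) *
      ind (csources G Λ n = Y ∧ CSupp G Λ E' n)) with hΦ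
  have hL : ∀ p : (edgesIn G Λ → ℕ) × (edgesIn G Λ → ℕ),
      ind (csources G Λ p.1 = X ∧ CSupp G Λ E' p.1) *
          ind (csources G Λ p.2 = Y ∧ CSupp G Λ E' p.2) *
            (gweight G Λ θ p.1 * gweight G Λ θ p.2 * H (p.1 + p.2)) =
        gweight G Λ θ p.1 * gweight G Λ θ p.2 * Φ (p.1 + p.2) p.2 := by
    intro p
    have hsub : p.1 + p.2 - p.2 = p.1 := by
      funext e; simp
    simp only [hΦ, hsub]
    ring
  simp_rw [hL]
  rw [tsum_pair_eq_tsum_cbinom_theta G Λ hθ Φ]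
  refine tsum_congr fun m => ?_
  congr 1
  have hinner : ∀ n, cbinom G Λ m n * Φ m n =
      H m * ind (CSupp G Λ E' m) * (cbinom G Λ m n *
        ind (csources G Λ (m - n) = X ∧ (csources G Λ n = Y ∧ CSupp G Λ E' n))) := by
    intro n
    by_cases hC : cbinom G Λ m n = 0
    · rw [hC, zero_mul, zero_mul, mul_zero]
    · simp only [hΦ]
      have hind : ind (csources G Λ (m - n) = X ∧ CSupp G Λ E' (m - n)) *
          ind (csources G Λ n = Y ∧ CSupp G Λ E' n) =
          ind (CSupp G Λ E' m) * ind (csources G Λ (m - n) = X ∧ (csources G Λ n = Y ∧ CSupp G Λ E' n)) := by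
        rw [← ind_and, ← ind_and]
        refine ind_congr ⟨fun ⟨⟨h1, h2⟩, h3, h4⟩ => ⟨((csupp_tsub_and_iff m n E').1 ⟨h2, h4⟩).1,
          h1, h3, h4⟩, fun ⟨h0, h1, h3, h4⟩ => ⟨⟨h1, ((csupp_tsub_and_iff m n E').2 ⟨h0, h4⟩).1⟩,
          h3, h4⟩⟩
      rw [hind]
      ring
  simp_rw [hinner]
  rw [ENNReal.tsum_mul_left, tsum_cbinom_ind_eq]

/-- Connection through charged edges of a current supported in `E'` only uses edges of `E'`. [folklore] -/
theorem CConn.of_csupp {n : edgesIn G Λ → ℕ} {E E' : Finset (Sym2 V)} {u v : V}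
    (h : CConn G Λ n E u v) (hs : CSupp G Λ E' n) : CConn G Λ n E' u v := by
  induction h with
  | refl => exact Relation.ReflTransGen.refl
  | tail _ hbc ih =>
    obtain ⟨e, -, hpos, hes⟩ := hbc
    exact ih.tail ⟨e, hs e hpos.ne', hpos, hes⟩

/-- Connection through charged edges is symmetric. [folklore] -/
theorem CConn.symm {m : edgesIn G Λ → ℕ} {E' : Finset (Sym2 V)} {u v : V}
    (h : CConn G Λ m E' u v) : CConn G Λ m E' v u := by
  induction h with
  | refl => exact Relation.ReflTransGen.refl
  | tail _ hbc ih =>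
    obtain ⟨e, he, hpos, hes⟩ := hbc
    exact Relation.ReflTransGen.head ⟨e, he, hpos, hes.trans Sym2.eq_swap⟩ ih

/-- If `u` and `v` are *not* connected through charged edges of `E'` in `m`, then no sub-current of
`m` inside `E'` has sources `{u} ∆ {v}`: `N_m(E', {u} ∆ {v}) = 0`. [folklore] -/
theorem switchCount_eq_zero_of_not_cconn {m : edgesIn G Λ → ℕ} {E' : Finset (Sym2 V)} {u v : V}
    (h : ¬CConn G Λ m E' u v) : switchCount G Λ m E' ({u} ∆ {v}) = 0 := by
  have huv : u ≠ v := by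
    rintro rfl
    exact h Relation.ReflTransGen.refl
  unfold switchCount
  refine ENNReal.tsum_eq_zero.2 fun n => ?_
  by_cases hC : cbinom G Λ m n = 0
  · rw [hC, zero_mul]
  · have hle : n ≤ m := fun e => le_of_cbinom_ne_zero hC e
    rw [ind_of_false, mul_zero]
    rintro ⟨hs, hsrc⟩
    have h1 : CConn G Λ n (edgesIn G Λ) u v := cconn_of_csources_eq huv hsrc
    exact h ((h1.of_csupp hs).mono hle)

variable (G Λ) in
/-- **The switching lemma with an arbitrary function of the sum** (Duminil-Copin–Tassion 2016,
Lemma 2.5 = Aizenman 1982; Griffiths–Hurst–Sherman 1970): for currents `n₁, n₂` supported in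
`E' ⊆ ℰ_Λ`, sources `A ⊆ Λ`, vertices `u, v` and any `F ≥ 0`,
`∑_{∂n₁ = A ∆ {u,v}, ∂n₂ = {u,v}} F(n₁+n₂) w(n₁)w(n₂)
   = ∑_{∂n₁ = A, ∂n₂ = ∅} F(n₁+n₂) w(n₁)w(n₂) 𝟙[u ⟷ v in n₁+n₂]`
(here `{u,v}` is the symmetric difference `{u} ∆ {v}`, so that `u = v` is allowed, and the
connection is through charged edges of `E'`). Proof: resum both sides over `m = n₁ + n₂`
(`tsum_pair_sources_eq`) and compare the binomially weighted counts of sub-currents: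
`N_m(E', {u,v}) = N_m(E', ∅)` if `u ⟷ v` in `m` (`switchCount_eq_of_cconn`), and
`N_m(E', {u,v}) = 0` otherwise. [cite: DuminilCopinTassionCMP2016, Lemma 2.5 (switching lemma), §2.3 (arXiv:1502.03050 numbering)] [cite: DuminilCopinECM2018, §3, Lemma 3.1] -/
theorem tsum_switching_theta {θ : Sym2 V → ℝ} (hθ : ∀ e, 0 ≤ θ e) (E' : Finset (Sym2 V))
    (A : Finset V) (u v : V) (F : (edgesIn G Λ → ℕ) → ℝ≥0∞) :
    ∑' p : (edgesIn G Λ → ℕ) × (edgesIn G Λ → ℕ),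
        ind (csources G Λ p.1 = A ∆ ({u} ∆ {v}) ∧ CSupp G Λ E' p.1) *
          ind (csources G Λ p.2 = {u} ∆ {v} ∧ CSupp G Λ E' p.2) *
            (gweight G Λ θ p.1 * gweight G Λ θ p.2 * F (p.1 + p.2)) =
      ∑' p : (edgesIn G Λ → ℕ) × (edgesIn G Λ → ℕ),
        ind (csources G Λ p.1 = A ∧ CSupp G Λ E' p.1) *
          ind (csources G Λ p.2 = ∅ ∧ CSupp G Λ E' p.2) *
            (gweight G Λ θ p.1 * gweight G Λ θ p.2 *
              (F (p.1 + p.2) * ind (CConn G Λ (p.1 + p.2) E' u v))) := by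
  rw [tsum_pair_sources_eq G Λ hθ E' _ _ F,
    tsum_pair_sources_eq G Λ hθ E' A ∅ (fun m => F m * ind (CConn G Λ m E' u v))]
  refine tsum_congr fun m => ?_
  congr 1
  have h1 : A ∆ (∅ : Finset V) = A := symmDiff_bot A
  have h2 : (∅ : Finset V) ∆ ({u} ∆ {v}) = {u} ∆ {v} := bot_symmDiff _
  rw [symmDiff_symmDiff_cancel_right, h1]
  by_cases hc : CConn G Λ m E' u v
  · rw [ind_of_true hc, mul_one, switchCount_eq_of_cconn m hc ∅, h2]
  · rw [ind_of_false hc, mul_zero, zero_mul, zero_mul, switchCount_eq_zero_of_not_cconn hc,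
      mul_zero, mul_zero]

/-! ### Restriction of currents to an edge set and factorisation across a cut

For the decompositions `n = n^S + n^{Λ∖S}` of Duminil-Copin–Tassion 2016, proof of Lemma 2.6
(Claims 1 and 2: "the two currents `n₁` and `n₂` vanish on every `{u,v}` with `u ∈ S` and
`v ∉ S`. Thus … we can decompose `nᵢ` as `nᵢ = nᵢ^S + nᵢ^{Λ∖S}` … `w(nᵢ) = w(nᵢ^{Λ∖S}) w(nᵢ^S)`"). -/

variable (G Λ) in
/-- The restriction `n^{E₁}` of a current to the edge set `E₁` (zero elsewhere)
(Duminil-Copin–Tassion 2016, proof of Lemma 2.6, Claim 1: "`nᵢ^A({u,v}) = nᵢ({u,v})` if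
`u, v ∈ A`, `0` otherwise"). [cite: DuminilCopinTassionCMP2016, proof of Lemma 2.6, Claim 1 (arXiv:1502.03050 numbering)] -/
def crestr (E₁ : Finset (Sym2 V)) (n : edgesIn G Λ → ℕ) : edgesIn G Λ → ℕ :=
  fun e => if (e : Sym2 V) ∈ E₁ then n e else 0

/-- `n^{E₁}` on an edge of `E₁`. [folklore] -/
theorem crestr_apply_of_mem {E₁ : Finset (Sym2 V)} (n : edgesIn G Λ → ℕ) {e : edgesIn G Λ}
    (he : (e : Sym2 V) ∈ E₁) : crestr G Λ E₁ n e = n e := by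
  simp [crestr, he]

/-- `n^{E₁}` off `E₁`. [folklore] -/
theorem crestr_apply_of_not_mem {E₁ : Finset (Sym2 V)} (n : edgesIn G Λ → ℕ) {e : edgesIn G Λ}
    (he : (e : Sym2 V) ∉ E₁) : crestr G Λ E₁ n e = 0 := by
  simp [crestr, he]

/-- `n^{E₁}` is supported in `E₁`. [folklore] -/
theorem csupp_crestr (E₁ : Finset (Sym2 V)) (n : edgesIn G Λ → ℕ) : CSupp G Λ E₁ (crestr G Λ E₁ n) := by
  intro e he
  by_contra h
  exact he (crestr_apply_of_not_mem n h)

/-- `n^{E₁} ≤ n`. [folklore] -/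
theorem crestr_le (E₁ : Finset (Sym2 V)) (n : edgesIn G Λ → ℕ) : crestr G Λ E₁ n ≤ n := by
  intro e
  by_cases he : (e : Sym2 V) ∈ E₁
  · rw [crestr_apply_of_mem n he]
  · rw [crestr_apply_of_not_mem n he]; exact Nat.zero_le _

/-- Restriction is additive. [folklore] -/
theorem crestr_add (E₁ : Finset (Sym2 V)) (n₁ n₂ : edgesIn G Λ → ℕ) :
    crestr G Λ E₁ (n₁ + n₂) = crestr G Λ E₁ n₁ + crestr G Λ E₁ n₂ := by
  funext e
  by_cases he : (e : Sym2 V) ∈ E₁ <;> simp [crestr, he]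

/-- A current supported in `E₁` is its own restriction. [folklore] -/
theorem crestr_eq_self_of_csupp {E₁ : Finset (Sym2 V)} {n : edgesIn G Λ → ℕ} (hs : CSupp G Λ E₁ n) :
    crestr G Λ E₁ n = n := by
  funext e
  by_cases he : (e : Sym2 V) ∈ E₁
  · exact crestr_apply_of_mem n he
  · rw [crestr_apply_of_not_mem n he]
    by_contra h
    exact he (hs e (Ne.symm h))

/-- A current supported in `E₂` has zero restriction to a disjoint `E₁`. [folklore] -/
theorem crestr_eq_zero_of_csupp {E₁ E₂ : Finset (Sym2 V)} (hdisj : Disjoint E₁ E₂)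
    {n : edgesIn G Λ → ℕ} (hs : CSupp G Λ E₂ n) : crestr G Λ E₁ n = 0 := by
  funext e
  by_cases he : (e : Sym2 V) ∈ E₁
  · rw [crestr_apply_of_mem n he, Pi.zero_apply]
    by_contra h
    exact disjoint_left.1 hdisj he (hs e h)
  · exact crestr_apply_of_not_mem n he

/-- A current with no charge outside `E₁ ⊔ E₂` is the sum of its two restrictions. [folklore] -/
theorem crestr_add_crestr_of_csupp {E₁ E₂ : Finset (Sym2 V)} (hdisj : Disjoint E₁ E₂)
    {n : edgesIn G Λ → ℕ} (hs : CSupp G Λ (E₁ ∪ E₂) n) :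
    crestr G Λ E₁ n + crestr G Λ E₂ n = n := by
  funext e
  simp only [Pi.add_apply]
  by_cases h1 : (e : Sym2 V) ∈ E₁
  · rw [crestr_apply_of_mem n h1, crestr_apply_of_not_mem n (disjoint_left.1 hdisj h1), add_zero]
  · rw [crestr_apply_of_not_mem n h1, zero_add]
    by_cases h2 : (e : Sym2 V) ∈ E₂
    · exact crestr_apply_of_mem n h2
    · rw [crestr_apply_of_not_mem n h2]
      by_contra h
      rcases mem_union.1 (hs e (Ne.symm h)) with h | h
      · exact h1 h
      · exact h2 h

/-- **`w(n) = w(n^{E₁}) w(n^{E₂})`** for a current with no charge outside the disjoint union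
`E₁ ⊔ E₂` (Duminil-Copin–Tassion 2016, proof of Lemma 2.6, Claim 1:
"`w(nᵢ) = w(nᵢ^{Λ∖S}) w(nᵢ^S)`"). [cite: DuminilCopinTassionCMP2016, proof of Lemma 2.6, Claim 1 (arXiv:1502.03050 numbering)] -/
theorem gweight_eq_mul_of_csupp_union (θ : Sym2 V → ℝ) {E₁ E₂ : Finset (Sym2 V)}
    (hdisj : Disjoint E₁ E₂) {n : edgesIn G Λ → ℕ} (hs : CSupp G Λ (E₁ ∪ E₂) n) :
    gweight G Λ θ n = gweight G Λ θ (crestr G Λ E₁ n) * gweight G Λ θ (crestr G Λ E₂ n) := by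
  unfold gweight
  rw [← prod_mul_distrib]
  refine prod_congr rfl fun e _ => ?_
  by_cases h1 : (e : Sym2 V) ∈ E₁
  · rw [crestr_apply_of_mem n h1, crestr_apply_of_not_mem n (disjoint_left.1 hdisj h1),
      edgeWeight_zero, mul_one]
  · rw [crestr_apply_of_not_mem n h1, edgeWeight_zero, one_mul]
    by_cases h2 : (e : Sym2 V) ∈ E₂
    · rw [crestr_apply_of_mem n h2]
    · rw [crestr_apply_of_not_mem n h2]
      have : n e = 0 := by
        by_contra h
        rcases mem_union.1 (hs e h) with h | h
        · exact h1 h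
        · exact h2 h
      rw [this]

/-- Off `E₁`, `n - n^{E₁} = n`; on `E₁` it vanishes. [folklore] -/
theorem tsub_crestr_apply (E₁ : Finset (Sym2 V)) (n : edgesIn G Λ → ℕ) (e : edgesIn G Λ) :
    (n - crestr G Λ E₁ n) e = if (e : Sym2 V) ∈ E₁ then 0 else n e := by
  simp only [Pi.sub_apply]
  by_cases he : (e : Sym2 V) ∈ E₁
  · rw [crestr_apply_of_mem n he, if_pos he, Nat.sub_self]
  · rw [crestr_apply_of_not_mem n he, if_neg he, Nat.sub_zero]

variable (G Λ) in
/-- **Factorisation of a sum over currents across a cut.** If the summand vanishes unless the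
current is supported in the disjoint union `E₁ ⊔ E₂` and otherwise only depends on the two
restrictions, the sum over currents is the double sum over a current inside `E₁` and a current
inside `E₂` (the bijection `n ↦ (n^{E₁}, n^{E₂})`; Duminil-Copin–Tassion 2016, proof of
Lemma 2.6, Claims 1–2). [cite: DuminilCopinTassionCMP2016, proof of Lemma 2.6, Claims 1–2 (arXiv:1502.03050 numbering)] -/
theorem tsum_eq_tsum_prod_of_csupp_union {E₁ E₂ : Finset (Sym2 V)} (hdisj : Disjoint E₁ E₂)
    (Ψ : (edgesIn G Λ → ℕ) → (edgesIn G Λ → ℕ) → ℝ≥0∞) :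
    ∑' n : edgesIn G Λ → ℕ, ind (CSupp G Λ (E₁ ∪ E₂) n) * Ψ (crestr G Λ E₁ n) (crestr G Λ E₂ n) =
      ∑' p : (edgesIn G Λ → ℕ) × (edgesIn G Λ → ℕ),
        ind (CSupp G Λ E₁ p.1 ∧ CSupp G Λ E₂ p.2) * Ψ p.1 p.2 := by
  set φ : (edgesIn G Λ → ℕ) → (edgesIn G Λ → ℕ) × (edgesIn G Λ → ℕ) :=
    fun n => (crestr G Λ E₁ n, n - crestr G Λ E₁ n) with hφ
  set f : (edgesIn G Λ → ℕ) × (edgesIn G Λ → ℕ) → ℝ≥0∞ :=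
    fun p => ind (CSupp G Λ E₁ p.1 ∧ CSupp G Λ E₂ p.2) * Ψ p.1 p.2 with hf
  have hinj : Function.Injective φ := by
    intro n n' h
    simp only [hφ, Prod.mk.injEq] at h
    obtain ⟨h1, h2⟩ := h
    have hn : n = crestr G Λ E₁ n + (n - crestr G Λ E₁ n) :=
      funext fun e => (Nat.add_sub_cancel' (crestr_le E₁ n e)).symm
    have hn' : n' = crestr G Λ E₁ n' + (n' - crestr G Λ E₁ n') :=
      funext fun e => (Nat.add_sub_cancel' (crestr_le E₁ n' e)).symm
    calc n = crestr G Λ E₁ n + (n - crestr G Λ E₁ n) := hn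
      _ = crestr G Λ E₁ n' + (n' - crestr G Λ E₁ n') := by rw [h2, h1]
      _ = n' := hn'.symm
  have hsupp : Function.support f ⊆ Set.range φ := by
    intro p hp
    have hind : CSupp G Λ E₁ p.1 ∧ CSupp G Λ E₂ p.2 := by
      by_contra h
      exact hp (by simp [hf, ind_of_false h])
    refine ⟨p.1 + p.2, ?_⟩
    have h1 : crestr G Λ E₁ (p.1 + p.2) = p.1 := by
      rw [crestr_add, crestr_eq_self_of_csupp hind.1, crestr_eq_zero_of_csupp hdisj hind.2, add_zero]
    show (crestr G Λ E₁ (p.1 + p.2), p.1 + p.2 - crestr G Λ E₁ (p.1 + p.2)) = p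
    rw [h1]
    exact Prod.ext rfl (funext fun e => by simp)
  rw [← hinj.tsum_eq hsupp]
  refine tsum_congr fun n => ?_
  simp only [hf, hφ]
  by_cases hs : CSupp G Λ (E₁ ∪ E₂) n
  · have h2 : n - crestr G Λ E₁ n = crestr G Λ E₂ n := by
      funext e
      rw [tsub_crestr_apply]
      by_cases h1 : (e : Sym2 V) ∈ E₁
      · rw [if_pos h1, crestr_apply_of_not_mem n (disjoint_left.1 hdisj h1)]
      · rw [if_neg h1]
        by_cases h2 : (e : Sym2 V) ∈ E₂
        · rw [crestr_apply_of_mem n h2]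
        · rw [crestr_apply_of_not_mem n h2]
          by_contra h
          rcases mem_union.1 (hs e h) with h | h
          · exact h1 h
          · exact h2 h
    rw [h2, ind_of_true hs, ind_of_true ⟨csupp_crestr E₁ n, csupp_crestr E₂ n⟩]
  · rw [ind_of_false hs, zero_mul, ind_of_false, zero_mul]
    rintro ⟨-, h2⟩
    apply hs
    intro e he
    by_cases h1 : (e : Sym2 V) ∈ E₁
    · exact mem_union_left _ h1
    · refine mem_union_right _ (h2 e ?_)
      rw [tsub_crestr_apply, if_neg h1]
      exact he

/-- A fourfold sum of a product of two functions of complementary pairs of variables factorises. [folklore] -/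
theorem tsum_prod_tsum_prod_mul {X : Type*} (F₁ F₂ : X → X → ℝ≥0∞) :
    ∑' r : X × X, ∑' q : X × X, F₁ r.1 q.1 * F₂ r.2 q.2 =
      (∑' a : X × X, F₁ a.1 a.2) * ∑' b : X × X, F₂ b.1 b.2 := by
  calc ∑' r : X × X, ∑' q : X × X, F₁ r.1 q.1 * F₂ r.2 q.2
      = ∑' (r₁ : X) (r₂ : X) (q₁ : X) (q₂ : X), F₁ r₁ q₁ * F₂ r₂ q₂ := by
        rw [ENNReal.tsum_prod']
        refine tsum_congr fun r₁ => tsum_congr fun r₂ => ?_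
        rw [ENNReal.tsum_prod']
    _ = ∑' (r₁ : X) (q₁ : X) (r₂ : X) (q₂ : X), F₁ r₁ q₁ * F₂ r₂ q₂ := by
        refine tsum_congr fun r₁ => ?_
        rw [ENNReal.tsum_comm]
    _ = ∑' (r₁ : X) (q₁ : X), F₁ r₁ q₁ * ∑' (r₂ : X) (q₂ : X), F₂ r₂ q₂ := by
        refine tsum_congr fun r₁ => tsum_congr fun q₁ => ?_
        rw [← ENNReal.tsum_mul_left]
        refine tsum_congr fun r₂ => ?_
        rw [← ENNReal.tsum_mul_left]
    _ = (∑' (r₁ : X) (q₁ : X), F₁ r₁ q₁) * ∑' (r₂ : X) (q₂ : X), F₂ r₂ q₂ := by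
        rw [← ENNReal.tsum_mul_right]
        refine tsum_congr fun r₁ => ?_
        rw [← ENNReal.tsum_mul_right]
    _ = (∑' a : X × X, F₁ a.1 a.2) * ∑' b : X × X, F₂ b.1 b.2 := by
        rw [ENNReal.tsum_prod', ENNReal.tsum_prod']

variable (G Λ) in
/-- **Factorisation for pairs of currents across a cut**: if both currents of a pair have no
charge outside `E₁ ⊔ E₂` and the summand is a product of a function of the two `E₁`-parts and a
function of the two `E₂`-parts, the double sum is the product of the two pair sums
(Duminil-Copin–Tassion 2016, proof of Lemma 2.6, Claims 1–2, the displays factorising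
`∑ w(n₁^S) …`). [cite: DuminilCopinTassionCMP2016, proof of Lemma 2.6, Claims 1–2 (arXiv:1502.03050 numbering)] -/
theorem tsum_pair_eq_mul_of_csupp_union {E₁ E₂ : Finset (Sym2 V)} (hdisj : Disjoint E₁ E₂)
    (G₁ G₂ : (edgesIn G Λ → ℕ) → (edgesIn G Λ → ℕ) → ℝ≥0∞) :
    ∑' p : (edgesIn G Λ → ℕ) × (edgesIn G Λ → ℕ),
        ind (CSupp G Λ (E₁ ∪ E₂) p.1) * ind (CSupp G Λ (E₁ ∪ E₂) p.2) *
          (G₁ (crestr G Λ E₁ p.1) (crestr G Λ E₁ p.2) * G₂ (crestr G Λ E₂ p.1) (crestr G Λ E₂ p.2)) =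
      (∑' a : (edgesIn G Λ → ℕ) × (edgesIn G Λ → ℕ),
          ind (CSupp G Λ E₁ a.1 ∧ CSupp G Λ E₁ a.2) * G₁ a.1 a.2) *
        ∑' b : (edgesIn G Λ → ℕ) × (edgesIn G Λ → ℕ),
          ind (CSupp G Λ E₂ b.1 ∧ CSupp G Λ E₂ b.2) * G₂ b.1 b.2 := by
  rw [ENNReal.tsum_prod']
  -- inner variable
  have step : ∀ n₁ : edgesIn G Λ → ℕ,
      ∑' n₂ : edgesIn G Λ → ℕ, ind (CSupp G Λ (E₁ ∪ E₂) n₁) * ind (CSupp G Λ (E₁ ∪ E₂) n₂) *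
          (G₁ (crestr G Λ E₁ n₁) (crestr G Λ E₁ n₂) * G₂ (crestr G Λ E₂ n₁) (crestr G Λ E₂ n₂)) =
        ind (CSupp G Λ (E₁ ∪ E₂) n₁) * ∑' q : (edgesIn G Λ → ℕ) × (edgesIn G Λ → ℕ),
          ind (CSupp G Λ E₁ q.1 ∧ CSupp G Λ E₂ q.2) *
            (G₁ (crestr G Λ E₁ n₁) q.1 * G₂ (crestr G Λ E₂ n₁) q.2) := by
    intro n₁
    have h := tsum_eq_tsum_prod_of_csupp_union G Λ hdisj
      (fun a b => G₁ (crestr G Λ E₁ n₁) a * G₂ (crestr G Λ E₂ n₁) b)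
    rw [← h, ← ENNReal.tsum_mul_left]
    exact tsum_congr fun n₂ => by ring
  simp_rw [step]
  -- outer variable
  have h2 := tsum_eq_tsum_prod_of_csupp_union G Λ hdisj (fun c e =>
    ∑' q : (edgesIn G Λ → ℕ) × (edgesIn G Λ → ℕ), ind (CSupp G Λ E₁ q.1 ∧ CSupp G Λ E₂ q.2) *
      (G₁ c q.1 * G₂ e q.2))
  rw [h2]
  -- regroup the indicators and apply the fourfold factorisation
  have h3 : ∀ (r q : (edgesIn G Λ → ℕ) × (edgesIn G Λ → ℕ)),
      ind (CSupp G Λ E₁ r.1 ∧ CSupp G Λ E₂ r.2) * (ind (CSupp G Λ E₁ q.1 ∧ CSupp G Λ E₂ q.2) *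
        (G₁ r.1 q.1 * G₂ r.2 q.2)) =
        (ind (CSupp G Λ E₁ r.1 ∧ CSupp G Λ E₁ q.1) * G₁ r.1 q.1) *
          (ind (CSupp G Λ E₂ r.2 ∧ CSupp G Λ E₂ q.2) * G₂ r.2 q.2) := by
    intro r q
    have : ind (CSupp G Λ E₁ r.1 ∧ CSupp G Λ E₂ r.2) * ind (CSupp G Λ E₁ q.1 ∧ CSupp G Λ E₂ q.2) =
        ind (CSupp G Λ E₁ r.1 ∧ CSupp G Λ E₁ q.1) * ind (CSupp G Λ E₂ r.2 ∧ CSupp G Λ E₂ q.2) := by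
      rw [← ind_and, ← ind_and]
      exact ind_congr ⟨fun ⟨⟨h1, h2⟩, h3, h4⟩ => ⟨⟨h1, h3⟩, h2, h4⟩, fun ⟨⟨h1, h3⟩, h2, h4⟩ => ⟨⟨h1, h2⟩, h3, h4⟩⟩
    calc ind (CSupp G Λ E₁ r.1 ∧ CSupp G Λ E₂ r.2) * (ind (CSupp G Λ E₁ q.1 ∧ CSupp G Λ E₂ q.2) *
          (G₁ r.1 q.1 * G₂ r.2 q.2))
        = (ind (CSupp G Λ E₁ r.1 ∧ CSupp G Λ E₂ r.2) * ind (CSupp G Λ E₁ q.1 ∧ CSupp G Λ E₂ q.2)) *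
            (G₁ r.1 q.1 * G₂ r.2 q.2) := by ring
      _ = _ := by rw [this]; ring
  calc ∑' r : (edgesIn G Λ → ℕ) × (edgesIn G Λ → ℕ), ind (CSupp G Λ E₁ r.1 ∧ CSupp G Λ E₂ r.2) *
        ∑' q : (edgesIn G Λ → ℕ) × (edgesIn G Λ → ℕ), ind (CSupp G Λ E₁ q.1 ∧ CSupp G Λ E₂ q.2) *
          (G₁ r.1 q.1 * G₂ r.2 q.2)
      = ∑' r : (edgesIn G Λ → ℕ) × (edgesIn G Λ → ℕ), ∑' q : (edgesIn G Λ → ℕ) × (edgesIn G Λ → ℕ),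
          (ind (CSupp G Λ E₁ r.1 ∧ CSupp G Λ E₁ q.1) * G₁ r.1 q.1) *
            (ind (CSupp G Λ E₂ r.2 ∧ CSupp G Λ E₂ q.2) * G₂ r.2 q.2) := by
        refine tsum_congr fun r => ?_
        rw [← ENNReal.tsum_mul_left]
        exact tsum_congr fun q => h3 r q
    _ = _ := tsum_prod_tsum_prod_mul (fun a b => ind (CSupp G Λ E₁ a ∧ CSupp G Λ E₁ b) * G₁ a b)
        (fun a b => ind (CSupp G Λ E₂ a ∧ CSupp G Λ E₂ b) * G₂ a b)

/-! ### Degrees and sources of restrictions across a cut -/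

/-- The degree of a restriction at a vertex all of whose charged edges lie in `E₁`. [folklore] -/
theorem cdeg_crestr_eq {E₁ : Finset (Sym2 V)} {n : edgesIn G Λ → ℕ} {v : V}
    (hv : ∀ e : edgesIn G Λ, v ∈ (e : Sym2 V) → n e ≠ 0 → (e : Sym2 V) ∈ E₁) :
    cdeg G Λ (crestr G Λ E₁ n) v = cdeg G Λ n v := by
  unfold cdeg
  refine sum_congr rfl fun e _ => ?_
  by_cases hve : v ∈ (e : Sym2 V)
  · rw [if_pos hve, if_pos hve]
    by_cases hn : n e = 0
    · rw [hn]
      by_cases he : (e : Sym2 V) ∈ E₁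
      · rw [crestr_apply_of_mem n he, hn]
      · rw [crestr_apply_of_not_mem n he]
    · rw [crestr_apply_of_mem n (hv e hve hn)]
  · rw [if_neg hve, if_neg hve]

/-- The degree of a restriction vanishes at a vertex off all edges of `E₁`. [folklore] -/
theorem cdeg_crestr_eq_zero {E₁ : Finset (Sym2 V)} {n : edgesIn G Λ → ℕ} {v : V}
    (hv : ∀ e : edgesIn G Λ, (e : Sym2 V) ∈ E₁ → v ∉ (e : Sym2 V)) :
    cdeg G Λ (crestr G Λ E₁ n) v = 0 := by
  unfold cdeg
  refine sum_eq_zero fun e _ => ?_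
  by_cases he : (e : Sym2 V) ∈ E₁
  · rw [if_neg (hv e he)]
  · rw [crestr_apply_of_not_mem n he, ite_self]

/-- The edges inside `S` and inside `Λ ∖ S` are disjoint. [folklore] -/
theorem disjoint_edgesIn_sdiff (S : Finset V) : Disjoint (edgesIn G S) (edgesIn G (Λ \ S)) := by
  rw [disjoint_left]
  intro e h1 h2
  rw [mem_edgesIn_iff] at h1 h2
  induction e using Sym2.ind with
  | _ x y => exact (mem_sdiff.1 (h2.2 x (Sym2.mem_mk_left x y))).2 (h1.2 x (Sym2.mem_mk_left x y))

/-- **Sources of the two parts of a current with no charged edge across the cut `(S, Λ ∖ S)`**: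
`∂(n^S) = ∂n ∩ S` (Duminil-Copin–Tassion 2016, proof of Lemma 2.6, Claim 1:
"`∂nᵢ^A = A ∩ ∂nᵢ`"). [cite: DuminilCopinTassionCMP2016, proof of Lemma 2.6, Claim 1 (arXiv:1502.03050 numbering)] -/
theorem csources_crestr_inner {S : Finset V} {n : edgesIn G Λ → ℕ}
    (hs : CSupp G Λ (edgesIn G S ∪ edgesIn G (Λ \ S)) n) :
    csources G Λ (crestr G Λ (edgesIn G S) n) = (csources G Λ n).filter (· ∈ S) := by
  ext v
  simp only [csources, mem_filter]
  by_cases hvS : v ∈ S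
  · rw [cdeg_crestr_eq]
    · tauto
    · intro e hve hne
      rcases mem_union.1 (hs e hne) with h | h
      · exact h
      · exact absurd hvS (mem_sdiff.1 ((mem_edgesIn_iff.1 h).2 v hve)).2
  · rw [cdeg_crestr_eq_zero]
    · simp [hvS]
    · intro e he hve
      exact hvS ((mem_edgesIn_iff.1 he).2 v hve)

/-- `∂(n^{Λ∖S}) = ∂n ∖ S` for a current with no charged edge across the cut. [cite: DuminilCopinTassionCMP2016, proof of Lemma 2.6, Claim 1 (arXiv:1502.03050 numbering)] -/
theorem csources_crestr_outer {S : Finset V} {n : edgesIn G Λ → ℕ}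
    (hs : CSupp G Λ (edgesIn G S ∪ edgesIn G (Λ \ S)) n) :
    csources G Λ (crestr G Λ (edgesIn G (Λ \ S)) n) = (csources G Λ n).filter (· ∉ S) := by
  ext v
  simp only [csources, mem_filter]
  by_cases hvS : v ∈ S
  · rw [cdeg_crestr_eq_zero]
    · simp [hvS]
    · intro e he hve
      exact (mem_sdiff.1 ((mem_edgesIn_iff.1 he).2 v hve)).2 hvS
  · rw [cdeg_crestr_eq]
    · tauto
    · intro e hve hne
      rcases mem_union.1 (hs e hne) with h | h
      · exact absurd ((mem_edgesIn_iff.1 h).2 v hve) hvS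
      · exact h

/-- A current supported in `E₁ ⊔ E₂`: both summands of a pair are, iff the pair is. [folklore] -/
theorem csupp_add_iff {E' : Finset (Sym2 V)} (n₁ n₂ : edgesIn G Λ → ℕ) :
    CSupp G Λ E' (n₁ + n₂) ↔ CSupp G Λ E' n₁ ∧ CSupp G Λ E' n₂ := by
  constructor
  · intro h
    exact ⟨fun e he => h e (by simp only [Pi.add_apply]; omega),
      fun e he => h e (by simp only [Pi.add_apply]; omega)⟩
  · rintro ⟨h1, h2⟩ e he
    simp only [Pi.add_apply] at he
    by_cases h : n₁ e = 0
    · exact h2 e (by omega)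
    · exact h1 e h

/-! ### The cluster complement `𝒮_b(m)` and its characterisation across a cut -/

variable (G Λ) in
/-- `𝒮_b(m)`: the vertices of `Λ` *not* connected to `b` through edges charged by `m`
(Duminil-Copin–Tassion 2016, proof of Lemma 2.6: "define `𝒮_z` to be the set of vertices in
`Λ ∪ {g}` that are not connected to `z` in `n₁ + n₂`"). [cite: DuminilCopinTassionCMP2016, proof of Lemma 2.6, definition of 𝒮_z (arXiv:1502.03050 numbering)] -/
def clusterCompl (m : edgesIn G Λ → ℕ) (b : V) : Finset V :=
  open Classical in Λ.filter fun v => ¬CConn G Λ m (edgesIn G Λ) b v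

open Classical in
/-- Membership in `𝒮_b(m)`. [folklore] -/
theorem mem_clusterCompl {m : edgesIn G Λ → ℕ} {b v : V} :
    v ∈ clusterCompl G Λ m b ↔ v ∈ Λ ∧ ¬CConn G Λ m (edgesIn G Λ) b v := by
  unfold clusterCompl; exact mem_filter

/-- `𝒮_b(m) ⊆ Λ`. [folklore] -/
theorem clusterCompl_subset (m : edgesIn G Λ → ℕ) (b : V) : clusterCompl G Λ m b ⊆ Λ :=
  fun _ hv => (mem_clusterCompl.1 hv).1

/-- `b ∉ 𝒮_b(m)`. [folklore] -/
theorem not_mem_clusterCompl_self (m : edgesIn G Λ → ℕ) (b : V) : b ∉ clusterCompl G Λ m b :=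
  fun h => (mem_clusterCompl.1 h).2 Relation.ReflTransGen.refl

/-- Exactly one value of `𝒮_b(m)`: `∑_{S ⊆ Λ} 𝟙[𝒮_b(m) = S] = 1`. [folklore] -/
theorem sum_ind_clusterCompl_eq (m : edgesIn G Λ → ℕ) (b : V) :
    ∑ S ∈ Λ.powerset, ind (clusterCompl G Λ m b = S) = 1 := by
  rw [sum_eq_single (clusterCompl G Λ m b), ind_of_true rfl]
  · intro S _ hS
    exact ind_of_false fun h => hS h.symm
  · intro h
    exact absurd (mem_powerset.2 (clusterCompl_subset m b)) h

/-- Connection through a smaller edge set implies connection through a larger one. [folklore] -/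
theorem CConn.mono_edges {m : edgesIn G Λ → ℕ} {E' E'' : Finset (Sym2 V)} (hsub : E' ⊆ E'')
    {u v : V} (h : CConn G Λ m E' u v) : CConn G Λ m E'' u v := by
  induction h with
  | refl => exact Relation.ReflTransGen.refl
  | tail _ hbc ih =>
    obtain ⟨e, he, hpos, hes⟩ := hbc
    exact ih.tail ⟨e, hsub he, hpos, hes⟩

/-- A vertex reached through edges inside `T` from `b` is `b` itself or lies in `T`. [folklore] -/
theorem CConn.eq_or_mem {m : edgesIn G Λ → ℕ} {T : Finset V} {b v : V}
    (h : CConn G Λ m (edgesIn G T) b v) : v = b ∨ v ∈ T := by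
  induction h with
  | refl => exact Or.inl rfl
  | tail _ hbc _ =>
    obtain ⟨e, he, -, hes⟩ := hbc
    right
    rw [hes] at he
    exact (mem_edgesIn_iff.1 he).2 _ (Sym2.mem_mk_right _ _)

/-- **`𝒮_b(m) = S` forces the absence of charged edges across the cut `(S, Λ ∖ S)`**
(Duminil-Copin–Tassion 2016, proof of Lemma 2.6, Claim 1: "When `𝒮_0 = S`, the two currents
… vanish on every `{u,v}` with `u ∈ S` and `v ∉ S`"). [cite: DuminilCopinTassionCMP2016, proof of Lemma 2.6, Claim 1 (arXiv:1502.03050 numbering)] -/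
theorem csupp_cut_of_clusterCompl_eq {m : edgesIn G Λ → ℕ} {b : V} {S : Finset V}
    (hS : clusterCompl G Λ m b = S) : CSupp G Λ (edgesIn G S ∪ edgesIn G (Λ \ S)) m := by
  intro e hne
  obtain ⟨e, heΛ⟩ := e
  induction e using Sym2.ind with
  | _ x y =>
    obtain ⟨hadj, hmem⟩ := mem_edgesIn_iff.1 heΛ
    have hx : x ∈ Λ := hmem x (Sym2.mem_mk_left x y)
    have hy : y ∈ Λ := hmem y (Sym2.mem_mk_right x y)
    have hiff : CConn G Λ m (edgesIn G Λ) b x ↔ CConn G Λ m (edgesIn G Λ) b y :=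
      CConn.edge_iff (e := ⟨s(x, y), heΛ⟩) heΛ (Nat.pos_of_ne_zero hne) rfl b
    have hxS : x ∈ S ↔ y ∈ S := by
      rw [← hS, mem_clusterCompl, mem_clusterCompl, hiff]
      exact ⟨fun h => ⟨hy, h.2⟩, fun h => ⟨hx, h.2⟩⟩
    by_cases hxS' : x ∈ S
    · refine mem_union_left _ (mem_edgesIn_iff.2 ⟨hadj, fun v hv => ?_⟩)
      rcases Sym2.mem_iff.1 hv with rfl | rfl
      · exact hxS'
      · exact hxS.1 hxS'
    · refine mem_union_right _ (mem_edgesIn_iff.2 ⟨hadj, fun v hv => ?_⟩)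
      rcases Sym2.mem_iff.1 hv with rfl | rfl
      · exact mem_sdiff.2 ⟨hx, hxS'⟩
      · exact mem_sdiff.2 ⟨hy, fun h => hxS' (hxS.2 h)⟩

/-- With no charged edge across the cut and `b ∈ Λ ∖ S`, connections from `b` through charged
edges of `ℰ_Λ` are connections through charged edges inside `Λ ∖ S`. [folklore] -/
theorem cconn_iff_cconn_outer {m : edgesIn G Λ → ℕ} {b : V} {S : Finset V}
    (hs : CSupp G Λ (edgesIn G S ∪ edgesIn G (Λ \ S)) m) (hb : b ∈ Λ \ S) (v : V) :
    CConn G Λ m (edgesIn G Λ) b v ↔ CConn G Λ m (edgesIn G (Λ \ S)) b v := by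
  refine ⟨fun h => ?_, fun h => h.mono_edges (edgesIn_mono G sdiff_subset)⟩
  suffices H : ∀ w, CConn G Λ m (edgesIn G Λ) b w →
      w ∈ Λ \ S ∧ CConn G Λ m (edgesIn G (Λ \ S)) b w from (H v h).2
  intro w hw
  induction hw with
  | refl => exact ⟨hb, Relation.ReflTransGen.refl⟩
  | @tail c c' _ hcc' ih =>
    obtain ⟨hc, hconn⟩ := ih
    obtain ⟨e, -, hpos, hes⟩ := hcc'
    have he' : (e : Sym2 V) ∈ edgesIn G (Λ \ S) := by
      rcases mem_union.1 (hs e hpos.ne') with h1 | h2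
      · exact absurd ((mem_edgesIn_iff.1 h1).2 c (hes ▸ Sym2.mem_mk_left c c')) (mem_sdiff.1 hc).2
      · exact h2
    exact ⟨(mem_edgesIn_iff.1 he').2 c' (hes ▸ Sym2.mem_mk_right c c'), hconn.tail ⟨e, he', hpos, hes⟩⟩

/-- **Characterisation of `𝒮_b(m) = S` across the cut**: for `S ⊆ Λ` and `b ∈ Λ ∖ S`,
`𝒮_b(m) = S` iff `m` has no charged edge across `(S, Λ ∖ S)` and every vertex of `Λ ∖ S` is
joined to `b` by charged edges inside `Λ ∖ S` — an event depending only on `m^{Λ∖S}`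
(Duminil-Copin–Tassion 2016, proof of Lemma 2.6, Claim 1: "`𝟙[𝒮_0 = S]` does not depend on
`n₁^S`"). [cite: DuminilCopinTassionCMP2016, proof of Lemma 2.6, Claim 1 (arXiv:1502.03050 numbering)] -/
theorem clusterCompl_eq_iff {m : edgesIn G Λ → ℕ} {b : V} {S : Finset V} (hSΛ : S ⊆ Λ)
    (hb : b ∈ Λ \ S) :
    clusterCompl G Λ m b = S ↔
      CSupp G Λ (edgesIn G S ∪ edgesIn G (Λ \ S)) m ∧
        ∀ v ∈ Λ \ S, CConn G Λ m (edgesIn G (Λ \ S)) b v := by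
  constructor
  · intro hS
    have hs := csupp_cut_of_clusterCompl_eq hS
    refine ⟨hs, fun v hv => ?_⟩
    rw [← cconn_iff_cconn_outer hs hb]
    by_contra hcon
    have : v ∈ clusterCompl G Λ m b := mem_clusterCompl.2 ⟨(mem_sdiff.1 hv).1, hcon⟩
    rw [hS] at this
    exact (mem_sdiff.1 hv).2 this
  · rintro ⟨hs, hall⟩
    ext v
    rw [mem_clusterCompl, cconn_iff_cconn_outer hs hb]
    constructor
    · rintro ⟨hvΛ, hnc⟩
      by_contra hvS
      exact hnc (hall v (mem_sdiff.2 ⟨hvΛ, hvS⟩))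
    · intro hvS
      refine ⟨hSΛ hvS, fun hc => ?_⟩
      rcases hc.eq_or_mem with rfl | hv
      · exact (mem_sdiff.1 hb).2 hvS
      · exact (mem_sdiff.1 hv).2 hvS

/-- Connection through charged edges of `E'` only depends on the restriction to `E'`. [folklore] -/
theorem cconn_crestr_iff {m : edgesIn G Λ → ℕ} {E' : Finset (Sym2 V)} {u v : V} :
    CConn G Λ (crestr G Λ E' m) E' u v ↔ CConn G Λ m E' u v := by
  unfold CConn
  have : (fun a c => ∃ e : edgesIn G Λ, (e : Sym2 V) ∈ E' ∧ 0 < crestr G Λ E' m e ∧ (e : Sym2 V) = s(a, c)) =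
      fun a c => ∃ e : edgesIn G Λ, (e : Sym2 V) ∈ E' ∧ 0 < m e ∧ (e : Sym2 V) = s(a, c) := by
    funext a c
    apply propext
    constructor
    · rintro ⟨e, he, hpos, hes⟩
      exact ⟨e, he, by rwa [crestr_apply_of_mem m he] at hpos, hes⟩
    · rintro ⟨e, he, hpos, hes⟩
      exact ⟨e, he, by rwa [crestr_apply_of_mem m he], hes⟩
  rw [this]

/-! ### Parity of the sources inside a cluster -/

open Classical in
/-- **The sources of a sub-current inside a cluster of the multigraph come in even number**
(the handshake lemma on the cluster; Duminil-Copin–Tassion 2016, proof of Lemma 2.6: the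
constraints on sources decide which of `x, y` is connected to `0`): for `n ≤ m` and any vertex
`b`, `#{v ∈ ∂n | b ⟷ v in m}` is even. [cite: DuminilCopinTassionCMP2016, proof of Lemma 2.6, the display defining δ_{x,y} (arXiv:1502.03050 numbering)] -/
theorem even_card_csources_filter_cconn {n m : edgesIn G Λ → ℕ} (hle : n ≤ m) (b : V) :
    Even #((csources G Λ n).filter fun v => CConn G Λ m (edgesIn G Λ) b v) := by
  set C : Finset V := Λ.filter (fun v => CConn G Λ m (edgesIn G Λ) b v) with hC
  have heven : Even (∑ v ∈ C, cdeg G Λ n v) := by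
    unfold cdeg
    rw [sum_comm]
    refine Finset.even_sum _ fun e _ => ?_
    rw [← sum_filter, sum_const, smul_eq_mul]
    by_cases hne : n e = 0
    · simp [hne]
    · have hpos : 0 < m e := (Nat.pos_of_ne_zero hne).trans_le (hle e)
      obtain ⟨e, he⟩ := e
      induction e using Sym2.ind with
      | _ x y =>
        obtain ⟨hadj, hmem⟩ := mem_edgesIn_iff.1 he
        have hxy : x ≠ y := G.ne_of_adj ((SimpleGraph.mem_edgeSet G).1 hadj)
        have hiff : x ∈ C ↔ y ∈ C := by
          simp only [hC, mem_filter]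
          rw [CConn.edge_iff (m := m) (E' := edgesIn G Λ) (e := ⟨s(x, y), he⟩) he hpos rfl b]
          exact ⟨fun h => ⟨hmem y (Sym2.mem_mk_right x y), h.2⟩,
            fun h => ⟨hmem x (Sym2.mem_mk_left x y), h.2⟩⟩
        by_cases hx : x ∈ C
        · have hy : y ∈ C := hiff.1 hx
          have : C.filter (fun v => v ∈ (s(x, y) : Sym2 V)) = {x, y} := by
            ext v
            simp only [mem_filter, Sym2.mem_iff, mem_insert, mem_singleton]
            constructor
            · exact fun h => h.2
            · intro h
              exact ⟨h.elim (fun h => h ▸ hx) (fun h => h ▸ hy), h⟩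
          rw [this, card_pair hxy]
          exact ⟨n ⟨s(x, y), he⟩, by ring⟩
        · have hy : y ∉ C := fun h => hx (hiff.2 h)
          have : C.filter (fun v => v ∈ (s(x, y) : Sym2 V)) = ∅ := by
            refine filter_eq_empty_iff.2 fun v hv hmemv => ?_
            rcases Sym2.mem_iff.1 hmemv with rfl | rfl
            · exact hx hv
            · exact hy hv
          rw [this, card_empty]
          simp
  rw [even_sum_iff_even_card_odd] at heven
  have hfilt : C.filter (fun v => Odd (cdeg G Λ n v)) =
      (csources G Λ n).filter fun v => CConn G Λ m (edgesIn G Λ) b v := by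
    ext v
    simp only [hC, csources, mem_filter]
    tauto
  rwa [hfilt] at heven

end Theta

/-! ## Part II. The ghost vertex

Duminil-Copin–Tassion 2016, §2.3: "We consider an additional vertex `g` not in `V`, called the
ghost vertex, and write `𝒫₂(S ∪ {g})` for the set of pairs … We also define `J_{x,g} = h/β` for
every `x ∈ Λ`." Here `g = none : Option V`, and the ghost is joined to the vertices of the fixed
finite volume `Λ` only, so that the ghost graph is locally finite. -/

section Ghost

variable (G : SimpleGraph V) (Λ : Finset V)

/-- The adjacency of the ghost graph: `G` on `V`, and `g ∼ x` for `x ∈ Λ`. [cite: DuminilCopinTassionCMP2016, §2.3 (the ghost vertex g) (arXiv:1502.03050 numbering)] -/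
def ghostAdj : Option V → Option V → Prop
  | some x, some y => G.Adj x y
  | some x, none => x ∈ Λ
  | none, some y => y ∈ Λ
  | none, none => False

/-- **The ghost graph** on `Λ ∪ {g}` (vertex type `Option V`, `g = none`): the graph `G`
together with an edge between the ghost and every vertex of `Λ` (Duminil-Copin–Tassion 2016,
§2.3; Griffiths' ghost spin). [cite: DuminilCopinTassionCMP2016, §2.3 (the ghost vertex g) (arXiv:1502.03050 numbering)] -/
def ghostGraph : SimpleGraph (Option V) where
  Adj := ghostAdj G Λ
  symm := ⟨by
    rintro (_ | x) (_ | y) h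
    · exact h
    · exact h
    · exact h
    · exact G.adj_symm h⟩
  loopless := ⟨by
    rintro (_ | x) h
    · exact h
    · exact G.irrefl h⟩

variable {G Λ}

omit [DecidableEq V] in
/-- Adjacency of two real vertices in the ghost graph. [folklore] -/
@[simp] theorem ghostGraph_adj_some_some {x y : V} : (ghostGraph G Λ).Adj (some x) (some y) ↔ G.Adj x y :=
  Iff.rfl

omit [DecidableEq V] in
/-- Adjacency of a real vertex and the ghost. [folklore] -/
@[simp] theorem ghostGraph_adj_some_none {x : V} : (ghostGraph G Λ).Adj (some x) none ↔ x ∈ Λ :=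
  Iff.rfl

omit [DecidableEq V] in
/-- Adjacency of the ghost and a real vertex. [folklore] -/
@[simp] theorem ghostGraph_adj_none_some {y : V} : (ghostGraph G Λ).Adj none (some y) ↔ y ∈ Λ :=
  Iff.rfl

omit [DecidableEq V] in
/-- The ghost is not adjacent to itself. [folklore] -/
@[simp] theorem ghostGraph_adj_none_none : ¬(ghostGraph G Λ).Adj none none := fun h => h

/-- Adjacency in the ghost graph is decidable. [folklore] -/
instance ghostGraph_decidableRel [DecidableRel G.Adj] : DecidableRel (ghostGraph G Λ).Adj
  | some x, some y => inferInstanceAs (Decidable (G.Adj x y))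
  | some x, none => inferInstanceAs (Decidable (x ∈ Λ))
  | none, some y => inferInstanceAs (Decidable (y ∈ Λ))
  | none, none => inferInstanceAs (Decidable False)

/-- The ghost graph is locally finite (the ghost has the finitely many neighbours `Λ`). [folklore] -/
instance ghostGraph_locallyFinite [G.LocallyFinite] : (ghostGraph G Λ).LocallyFinite := by
  rintro (_ | x)
  · refine Fintype.ofFinset (Λ.map Function.Embedding.some) ?_
    rintro (_ | y)
    · simp only [SimpleGraph.mem_neighborSet, ghostGraph_adj_none_none, iff_false, mem_map,
        Function.Embedding.some_apply, not_exists, not_and]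
      exact fun z _ h => Option.some_ne_none z h
    · simp [SimpleGraph.mem_neighborSet]
  · refine Fintype.ofFinset ((G.neighborFinset x).map Function.Embedding.some ∪
      (if x ∈ Λ then {none} else ∅)) ?_
    rintro (_ | y)
    · by_cases hx : x ∈ Λ <;> simp [SimpleGraph.mem_neighborSet, hx]
    · by_cases hx : x ∈ Λ <;> simp [SimpleGraph.mem_neighborSet, hx]

/-- The lift `{x,y} ↦ {x,y}` of an edge of `V` to the ghost vertex type. [folklore] -/
def liftEdge : Sym2 V ↪ Sym2 (Option V) :=
  ⟨Sym2.map some, Sym2.map.injective (Option.some_injective V)⟩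

omit [DecidableEq V] in
/-- `liftEdge s(x,y) = s(some x, some y)`. [folklore] -/
@[simp] theorem liftEdge_mk (x y : V) : liftEdge s(x, y) = s(some x, some y) := rfl

omit [DecidableEq V] in
/-- The ghost is not an endpoint of a lifted edge. [folklore] -/
theorem none_not_mem_liftEdge (e : Sym2 V) : (none : Option V) ∉ liftEdge e := by
  induction e using Sym2.ind with
  | _ x y => simp [liftEdge_mk]

/-- The ghost edge `{x, g}` of a real vertex. [cite: DuminilCopinTassionCMP2016, §2.3 (pairs {x,g}) (arXiv:1502.03050 numbering)] -/
def ghostEdge : V ↪ Sym2 (Option V) :=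
  ⟨fun x => s(some x, none), fun x y h => by
    rcases Sym2.eq_iff.1 h with ⟨h1, -⟩ | ⟨-, h2⟩
    · exact Option.some_injective _ h1
    · exact absurd h2.symm (Option.some_ne_none y)⟩

omit [DecidableEq V] in
/-- `ghostEdge x = s(some x, none)`. [folklore] -/
@[simp] theorem ghostEdge_apply (x : V) : ghostEdge x = s(some x, none) := rfl

omit [DecidableEq V] in
/-- The ghost is an endpoint of every ghost edge. [folklore] -/
theorem none_mem_ghostEdge (x : V) : (none : Option V) ∈ ghostEdge x := by
  simp

omit [DecidableEq V] in
/-- A lifted edge is not a ghost edge. [folklore] -/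
theorem liftEdge_ne_ghostEdge (e : Sym2 V) (x : V) : liftEdge e ≠ ghostEdge x := fun h =>
  none_not_mem_liftEdge e (h ▸ none_mem_ghostEdge x)

variable [G.LocallyFinite]

/-- **The edges of the ghost graph inside `S ∪ {g}`**, `S ⊆ Λ`: the edges of `G` inside `S`
and the ghost edges at the vertices of `S` (Duminil-Copin–Tassion 2016, §2.3: currents on `S`
are functions on the pairs of `S ∪ {g}`, with `J_{x,y} = 0` off the edges). [cite: DuminilCopinTassionCMP2016, §2.3, Def. 2.4 (arXiv:1502.03050 numbering)] -/
theorem edgesIn_ghostGraph_insertNone {S : Finset V} (hS : S ⊆ Λ) :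
    edgesIn (ghostGraph G Λ) (Finset.insertNone S) = (edgesIn G S).map liftEdge ∪ S.map ghostEdge := by
  ext e
  rw [mem_union, mem_edgesIn_iff, mem_map, mem_map]
  induction e using Sym2.ind with
  | _ a b =>
    rcases a with _ | x <;> rcases b with _ | y
    · -- `(g, g)`
      simp only [SimpleGraph.mem_edgeSet, ghostGraph_adj_none_none, false_and, false_iff, not_or,
        not_exists, not_and]
      refine ⟨fun e _ h => none_not_mem_liftEdge e (h.symm ▸ Sym2.mem_mk_left _ _),
        fun z _ h => ?_⟩
      have h' : s(some z, none) = s(none, none) := h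
      rcases Sym2.eq_iff.1 h' with ⟨h1, -⟩ | ⟨h1, -⟩ <;> exact Option.some_ne_none z h1
    · -- `(g, y)`
      constructor
      · rintro ⟨hadj, hmem⟩
        right
        refine ⟨y, ?_, Sym2.eq_swap⟩
        simpa using hmem (some y) (Sym2.mem_mk_right _ _)
      · rintro (⟨e, -, he⟩ | ⟨z, hz, hze⟩)
        · exact absurd (he ▸ Sym2.mem_mk_left _ _) (none_not_mem_liftEdge e)
        · have hzy : z = y := by
            have h' : s(some z, none) = s(none, some y) := hze
            rcases Sym2.eq_iff.1 h' with ⟨h1, -⟩ | ⟨h1, -⟩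
            · exact absurd h1 (Option.some_ne_none z)
            · exact Option.some_injective _ h1
          subst hzy
          refine ⟨?_, ?_⟩
          · exact (SimpleGraph.mem_edgeSet _).2 (ghostGraph_adj_none_some.2 (hS hz))
          · rintro v hv
            rcases Sym2.mem_iff.1 hv with rfl | rfl <;> simp [Finset.mem_insertNone, hz]
    · -- `(x, g)`
      constructor
      · rintro ⟨hadj, hmem⟩
        right
        exact ⟨x, by simpa using hmem (some x) (Sym2.mem_mk_left _ _), rfl⟩
      · rintro (⟨e, -, he⟩ | ⟨z, hz, hze⟩)
        · exact absurd (he ▸ Sym2.mem_mk_right _ _) (none_not_mem_liftEdge e)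
        · have hzx : z = x := ghostEdge.injective hze
          subst hzx
          refine ⟨(SimpleGraph.mem_edgeSet _).2 (ghostGraph_adj_some_none.2 (hS hz)), ?_⟩
          rintro v hv
          rcases Sym2.mem_iff.1 hv with rfl | rfl <;> simp [Finset.mem_insertNone, hz]
    · -- `(x, y)`
      constructor
      · rintro ⟨hadj, hmem⟩
        left
        refine ⟨s(x, y), mem_edgesIn_iff.2 ⟨?_, fun v hv => ?_⟩, rfl⟩
        · exact (SimpleGraph.mem_edgeSet G).2 (ghostGraph_adj_some_some.1 ((SimpleGraph.mem_edgeSet _).1 hadj))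
        · rcases Sym2.mem_iff.1 hv with rfl | rfl
          · simpa using hmem (some v) (Sym2.mem_mk_left _ _)
          · simpa using hmem (some v) (Sym2.mem_mk_right _ _)
      · rintro (⟨e, he, hexy⟩ | ⟨z, -, hze⟩)
        · induction e using Sym2.ind with
          | _ u w =>
            rw [liftEdge_mk] at hexy
            obtain ⟨hadj, hmem⟩ := mem_edgesIn_iff.1 he
            have hadj' : G.Adj u w := (SimpleGraph.mem_edgeSet G).1 hadj
            refine ⟨?_, fun v hv => ?_⟩
            · rw [← hexy]
              exact (SimpleGraph.mem_edgeSet _).2 (ghostGraph_adj_some_some.2 hadj')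
            · rw [← hexy] at hv
              rcases Sym2.mem_iff.1 hv with rfl | rfl
              · simpa using hmem u (Sym2.mem_mk_left u w)
              · simpa using hmem w (Sym2.mem_mk_right u w)
        · exfalso
          have h' : s(some z, none) = s(some x, some y) := hze
          rcases Sym2.eq_iff.1 h' with ⟨-, h2⟩ | ⟨-, h2⟩
          · exact Option.some_ne_none y h2.symm
          · exact Option.some_ne_none x h2.symm

omit [DecidableEq V] [G.LocallyFinite] in
/-- The lifted edges and the ghost edges are disjoint. [folklore] -/
theorem disjoint_map_liftEdge_map_ghostEdge (E : Finset (Sym2 V)) (S : Finset V) :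
    Disjoint (E.map liftEdge) (S.map ghostEdge) := by
  rw [disjoint_left]
  rintro e he hg
  obtain ⟨e', -, rfl⟩ := mem_map.1 he
  obtain ⟨x, -, hx⟩ := mem_map.1 hg
  exact liftEdge_ne_ghostEdge e' x hx.symm

/-- Lifted edges inside `S ∪ {g}`. [folklore] -/
theorem map_liftEdge_subset_edgesIn {S : Finset V} (hS : S ⊆ Λ) :
    (edgesIn G S).map liftEdge ⊆ edgesIn (ghostGraph G Λ) (Finset.insertNone S) := by
  rw [edgesIn_ghostGraph_insertNone hS]; exact subset_union_left

/-- Ghost edges inside `S ∪ {g}`. [folklore] -/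
theorem map_ghostEdge_subset_edgesIn {S : Finset V} (hS : S ⊆ Λ) :
    S.map ghostEdge ⊆ edgesIn (ghostGraph G Λ) (Finset.insertNone S) := by
  rw [edgesIn_ghostGraph_insertNone hS]; exact subset_union_right

/-- Edges inside `S ∪ {g}` are edges inside `Λ ∪ {g}` for `S ⊆ Λ`. [folklore] -/
theorem edgesIn_insertNone_mono {S : Finset V} (hS : S ⊆ Λ) :
    edgesIn (ghostGraph G Λ) (Finset.insertNone S) ⊆ edgesIn (ghostGraph G Λ) (Finset.insertNone Λ) :=
  edgesIn_mono (ghostGraph G Λ) (Finset.insertNone.monotone hS)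

/-- A sum over the edges inside `S ∪ {g}` splits into the edges of `G` inside `S` and the ghost
edges at `S`. [folklore] -/
theorem sum_edgesIn_ghostGraph {M : Type*} [AddCommMonoid M] {S : Finset V} (hS : S ⊆ Λ)
    (f : Sym2 (Option V) → M) :
    ∑ e ∈ edgesIn (ghostGraph G Λ) (Finset.insertNone S), f e =
      ∑ e ∈ edgesIn G S, f (liftEdge e) + ∑ x ∈ S, f (ghostEdge x) := by
  rw [edgesIn_ghostGraph_insertNone hS, sum_union (disjoint_map_liftEdge_map_ghostEdge _ _), sum_map,
    sum_map]

/-- A product over the edges inside `S ∪ {g}` splits likewise. [folklore] -/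
theorem prod_edgesIn_ghostGraph {M : Type*} [CommMonoid M] {S : Finset V} (hS : S ⊆ Λ)
    (f : Sym2 (Option V) → M) :
    ∏ e ∈ edgesIn (ghostGraph G Λ) (Finset.insertNone S), f e =
      (∏ e ∈ edgesIn G S, f (liftEdge e)) * ∏ x ∈ S, f (ghostEdge x) := by
  rw [edgesIn_ghostGraph_insertNone hS, prod_union (disjoint_map_liftEdge_map_ghostEdge _ _), prod_map,
    prod_map]

/-! ### Couplings `β` on the edges of `G`, `βh` on the ghost edges; the lifted spin configuration -/

/-- The couplings of the Ising model with field on the ghost graph: `θ_e = β` on the edges of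
`G` and `θ_{x,g} = k` on the ghost edges (Duminil-Copin–Tassion 2016, §2.3: `βJ_{x,g} = h`;
in the tree's parametrisation `μ ∝ exp(β ∑ σ_xσ_y + βh ∑ σ_x)` one takes `k = βh`). [cite: DuminilCopinTassionCMP2016, §2.3 (J_{x,g} = h/β) (arXiv:1502.03050 numbering)] -/
def ghostCoupling (β k : ℝ) (e : Sym2 (Option V)) : ℝ :=
  if (none : Option V) ∈ e then k else β

/-- The coupling of a lifted edge is `β`. [folklore] -/
@[simp] theorem ghostCoupling_liftEdge (β k : ℝ) (e : Sym2 V) : ghostCoupling β k (liftEdge e) = β := by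
  rw [ghostCoupling, if_neg (none_not_mem_liftEdge e)]

/-- The coupling of a ghost edge is `k`. [folklore] -/
@[simp] theorem ghostCoupling_ghostEdge (β k : ℝ) (x : V) : ghostCoupling β k (ghostEdge x) = k := by
  rw [ghostCoupling, if_pos (none_mem_ghostEdge x)]

/-- The couplings are nonnegative for `β, k ≥ 0`. [folklore] -/
theorem ghostCoupling_nonneg {β k : ℝ} (hβ : 0 ≤ β) (hk : 0 ≤ k) (e : Sym2 (Option V)) :
    0 ≤ ghostCoupling β k e := by
  unfold ghostCoupling; split_ifs <;> assumption

/-- The lifted spin configuration: the given spins on `V` and `+1` at the ghost (Griffiths' ghost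
spin; Duminil-Copin–Tassion 2016, §2.3). [cite: DuminilCopinTassionCMP2016, §2.3 (the ghost vertex g) (arXiv:1502.03050 numbering)] -/
def liftSpin (σ : SpinConfig V) : SpinConfig (Option V) := fun v => v.elim 1 σ

omit [DecidableEq V] in
/-- The lifted configuration at a real vertex. [folklore] -/
@[simp] theorem spinAt_liftSpin_some (σ : SpinConfig V) (x : V) : spinAt (some x) (liftSpin σ) = spinAt x σ :=
  rfl

omit [DecidableEq V] in
/-- The ghost spin is `+1`. [folklore] -/
@[simp] theorem spinAt_liftSpin_none (σ : SpinConfig V) : spinAt (none : Option V) (liftSpin σ) = 1 := by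
  simp [spinAt, liftSpin]

omit [DecidableEq V] in
/-- Bond spins of lifted edges. [folklore] -/
@[simp] theorem bondSpin_liftSpin_liftEdge (σ : SpinConfig V) (e : Sym2 V) :
    bondSpin (liftSpin σ) (liftEdge e) = bondSpin σ e := by
  induction e using Sym2.ind with
  | _ x y => rw [liftEdge_mk, bondSpin_mk, bondSpin_mk, spinAt_liftSpin_some, spinAt_liftSpin_some]

omit [DecidableEq V] in
/-- Bond spins of ghost edges are the spins: `σ_x σ_g = σ_x`. [folklore] -/
@[simp] theorem bondSpin_liftSpin_ghostEdge (σ : SpinConfig V) (x : V) :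
    bondSpin (liftSpin σ) (ghostEdge x) = spinAt x σ := by
  rw [ghostEdge_apply, bondSpin_mk, spinAt_liftSpin_some, spinAt_liftSpin_none, mul_one]

/-- Spin products of the lifted configuration only see the real vertices:
`σ⁺_B = σ_{B ∖ {g}}`. [folklore] -/
theorem spinProduct_liftSpin (B : Finset (Option V)) (σ : SpinConfig V) :
    spinProduct B (liftSpin σ) = spinProduct (Finset.eraseNone B) σ := by
  unfold spinProduct
  have h1 : ∏ x ∈ Finset.eraseNone B, spinAt x σ = ∏ v ∈ (Finset.eraseNone B).map Function.Embedding.some,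
      spinAt v (liftSpin σ) := by
    rw [prod_map]; rfl
  rw [h1, Finset.map_some_eraseNone]
  by_cases hn : (none : Option V) ∈ B
  · rw [← mul_prod_erase B _ hn, spinAt_liftSpin_none, one_mul]
  · rw [erase_eq_of_notMem hn]

/-! ### Parity of odd-degree vertices and the source set `A*` -/

omit [G.LocallyFinite] in
/-- **Handshake**: an edge set inside `Λ'` has an even number of odd-degree vertices in `Λ'`. [folklore] -/
theorem even_card_oddVerts {W : Type*} [DecidableEq W] {G' : SimpleGraph W} [G'.LocallyFinite]
    {Λ' : Finset W} {F : Finset (Sym2 W)} (hF : F ⊆ edgesIn G' Λ') : Even #(oddVerts Λ' F) := by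
  have hsum : ∑ v ∈ Λ', #(F.filter fun e => v ∈ e) = ∑ e ∈ F, #(Λ'.filter fun v => v ∈ e) := by
    simp only [card_filter]
    exact sum_comm
  have h2 : ∀ e ∈ F, #(Λ'.filter fun v => v ∈ e) = 2 := by
    intro e he
    have he' := hF he
    induction e using Sym2.ind with
    | _ x y =>
      have hxy : x ≠ y := G'.ne_of_adj ((SimpleGraph.mem_edgeSet G').1 (mem_edgesIn_iff.1 he').1)
      rw [filter_mem_edge_eq he', card_pair hxy]
  have heven : Even (∑ v ∈ Λ', #(F.filter fun e => v ∈ e)) := by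
    rw [hsum, sum_congr rfl h2, sum_const, smul_eq_mul]
    exact ⟨#F, by ring⟩
  rw [even_sum_iff_even_card_odd] at heven
  exact heven

omit [G.LocallyFinite] in
/-- The source set `A*` on `Λ ∪ {g}` of a set `A` of real vertices: `A` if `|A|` is even,
`A ∪ {g}` if `|A|` is odd (Duminil-Copin–Tassion 2016, eq. (2.2): "`∂n = A` if `A` is even,
`∂n = A ∪ {g}` if `A` is odd"). [cite: DuminilCopinTassionCMP2016, §2.3, eq. (2.2) (arXiv:1502.03050 numbering)] -/
def starSet (A : Finset V) : Finset (Option V) :=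
  if Even #A then A.map Function.Embedding.some else Finset.insertNone A

omit [DecidableEq V] [G.LocallyFinite] in
/-- `∅* = ∅`. [folklore] -/
@[simp] theorem starSet_empty : starSet (∅ : Finset V) = ∅ := by
  simp [starSet]

omit [DecidableEq V] [G.LocallyFinite] in
/-- `A* = A` for `|A|` even. [folklore] -/
theorem starSet_of_even {A : Finset V} (h : Even #A) : starSet A = A.map Function.Embedding.some := by
  rw [starSet, if_pos h]

omit [DecidableEq V] [G.LocallyFinite] in
/-- The real part of `A*` is `A`. [folklore] -/
theorem eraseNone_starSet (A : Finset V) : Finset.eraseNone (starSet A) = A := by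
  unfold starSet
  split_ifs
  · exact Finset.eraseNone_map_some A
  · exact Finset.eraseNone_insertNone A

omit [G.LocallyFinite] in
/-- A set of vertices of `Λ ∪ {g}` of even cardinality is determined by its real part: it is
`A*` iff its real part is `A` (the parity decides whether the ghost belongs to it). [folklore] -/
theorem eraseNone_eq_iff_eq_starSet {O : Finset (Option V)} (hO : Even #O) (A : Finset V) :
    Finset.eraseNone O = A ↔ O = starSet A := by
  constructor
  · intro h
    subst h
    by_cases hn : (none : Option V) ∈ O
    · have hO' : O = Finset.insertNone (Finset.eraseNone O) := by
        rw [Finset.insertNone_eraseNone, insert_eq_of_mem hn]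
      have hodd : ¬Even #(Finset.eraseNone O) := by
        intro he
        rw [hO', Finset.card_insertNone] at hO
        exact Nat.not_even_iff_odd.2 (Even.add_one he) hO
      rw [starSet, if_neg hodd, ← hO']
    · have hO' : O = (Finset.eraseNone O).map Function.Embedding.some := by
        rw [Finset.map_some_eraseNone, erase_eq_of_notMem hn]
      have heven : Even #(Finset.eraseNone O) := by
        rwa [Finset.card_eraseNone_of_not_mem hn]
      rw [starSet, if_pos heven, ← hO']
  · rintro rfl
    exact eraseNone_starSet A

/-! ### The high-temperature expansion with a magnetic field -/

/-- **The Boltzmann weight with field as a product over the edges of the ghost graph**: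
`e^{-βℋ^∅_{S;h}(σ)} = ∏_{e ∈ ℰ⁺_S} e^{θ_e σ⁺_e}` with the lifted configuration `σ⁺` (`σ_g = +1`),
`θ = β` on the edges of `G` and `θ = βh` on the ghost edges (Duminil-Copin–Tassion 2016, §2.3:
the field as the coupling `J_{x,g}` to the ghost). [cite: DuminilCopinTassionCMP2016, §2.3 (J_{x,g} = h/β) (arXiv:1502.03050 numbering)] -/
theorem isingWeight_free_eq_prod_ghost {S : Finset V} (hS : S ⊆ Λ) (β h : ℝ) (τ : S → ℤˣ) :
    isingWeight G S β h .free τ =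
      ∏ e ∈ edgesIn (ghostGraph G Λ) (Finset.insertNone S),
        Real.exp (ghostCoupling β (β * h) e * bondSpin (liftSpin (glue S τ .free)) e) := by
  rw [← Real.exp_sum, sum_edgesIn_ghostGraph hS, isingWeight, isingHamiltonian, interactionEdges_free]
  congr 1
  simp only [ghostCoupling_liftEdge, ghostCoupling_ghostEdge, bondSpin_liftSpin_liftEdge,
    bondSpin_liftSpin_ghostEdge]
  rw [show -β * (-(∑ e ∈ edgesIn G S, bondSpin (glue S τ .free) e) - h * ∑ x ∈ S, spinAt x (glue S τ .free)) =
      β * ∑ e ∈ edgesIn G S, bondSpin (glue S τ .free) e + (β * h) * ∑ x ∈ S, spinAt x (glue S τ .free) by ring,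
    mul_sum, mul_sum]

/-- **High-temperature expansion of the Boltzmann weight with field**:
`e^{-βℋ^∅_{S;h}(σ)} = ∑_{F ⊆ ℰ⁺_S} (∏_{e∈F} sinh θ_e)(∏_{e ∈ ℰ⁺_S ∖ F} cosh θ_e) σ_{∂F ∖ {g}}`
(Duminil-Copin 2016, §2.2.1, with the ghost edges carrying the field). [cite: DuminilCopinECM2018, §2.2.1 (high-temperature expansion)] -/
theorem isingWeight_free_field_eq_sum {S : Finset V} (hS : S ⊆ Λ) (β h : ℝ) (τ : S → ℤˣ) :
    isingWeight G S β h .free τ =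
      ∑ F ∈ (edgesIn (ghostGraph G Λ) (Finset.insertNone S)).powerset,
        ((∏ e ∈ F, Real.sinh (ghostCoupling β (β * h) e)) *
            ∏ e ∈ edgesIn (ghostGraph G Λ) (Finset.insertNone S) \ F, Real.cosh (ghostCoupling β (β * h) e)) *
          spinProduct (Finset.eraseNone (oddVerts (Finset.insertNone S) F)) (glue S τ .free) := by
  rw [isingWeight_free_eq_prod_ghost hS]
  simp_rw [exp_mul_bondSpin, add_comm (Real.cosh _)]
  rw [prod_add]
  refine sum_congr rfl fun F hF => ?_
  rw [prod_mul_distrib, prod_bondSpin_eq_spinProduct_oddVerts (ghostGraph G Λ) (mem_powerset.1 hF),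
    spinProduct_liftSpin]
  ring

/-- **High-temperature expansion of Boltzmann sums with field** (Duminil-Copin 2016, §2.2.1;
Duminil-Copin–Tassion 2016, eq. (2.2) through the ghost): for `S ⊆ Λ` and `A ⊆ S`,
`∑_τ e^{-βℋ(τ)} σ_A(τ) = 2^{|S|} ∑_{F ⊆ ℰ⁺_S, ∂F = A*} (∏_{F} sinh θ_e)(∏_{ℰ⁺_S ∖ F} cosh θ_e)`. [cite: DuminilCopinECM2018, §2.2.1 (high-temperature expansion)] [cite: DuminilCopinTassionCMP2016, §2.3, eq. (2.2) (arXiv:1502.03050 numbering)] -/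
theorem boltzmannSum_free_field_eq {S : Finset V} (hS : S ⊆ Λ) (β h : ℝ) {A : Finset V} (hA : A ⊆ S) :
    ∑ τ : S → ℤˣ, isingWeight G S β h .free τ * spinProduct A (glue S τ .free) =
      Fintype.card (S → ℤˣ) *
        ∑ F ∈ (edgesIn (ghostGraph G Λ) (Finset.insertNone S)).powerset with
            oddVerts (Finset.insertNone S) F = starSet A,
          (∏ e ∈ F, Real.sinh (ghostCoupling β (β * h) e)) *
            ∏ e ∈ edgesIn (ghostGraph G Λ) (Finset.insertNone S) \ F, Real.cosh (ghostCoupling β (β * h) e) := by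
  set E := edgesIn (ghostGraph G Λ) (Finset.insertNone S) with hE
  set c : Finset (Sym2 (Option V)) → ℝ := fun F =>
    (∏ e ∈ F, Real.sinh (ghostCoupling β (β * h) e)) *
      ∏ e ∈ E \ F, Real.cosh (ghostCoupling β (β * h) e) with hc
  have hOsub : ∀ F ∈ E.powerset, Finset.eraseNone (oddVerts (Finset.insertNone S) F) ⊆ S := by
    intro F _ x hx
    rw [Finset.mem_eraseNone] at hx
    exact Finset.some_mem_insertNone.1 (oddVerts_subset _ _ hx)
  calc ∑ τ : S → ℤˣ, isingWeight G S β h .free τ * spinProduct A (glue S τ .free)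
      = ∑ τ : S → ℤˣ, ∑ F ∈ E.powerset,
          c F * spinProduct (Finset.eraseNone (oddVerts (Finset.insertNone S) F) ∆ A) (glue S τ .free) := by
        refine sum_congr rfl fun τ _ => ?_
        rw [isingWeight_free_field_eq_sum hS, sum_mul]
        refine sum_congr rfl fun F _ => ?_
        rw [mul_assoc, spinProduct_mul_spinProduct]
    _ = ∑ F ∈ E.powerset, c F *
          if Finset.eraseNone (oddVerts (Finset.insertNone S) F) ∆ A = ∅ then (Fintype.card (S → ℤˣ) : ℝ) else 0 := by
        rw [sum_comm]
        refine sum_congr rfl fun F hF => ?_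
        rw [← mul_sum, sum_spinProduct_glue (symmDiff_le_sup.trans (sup_le (hOsub F hF) hA))]
    _ = ∑ F ∈ E.powerset with oddVerts (Finset.insertNone S) F = starSet A, c F * Fintype.card (S → ℤˣ) := by
        rw [sum_filter]
        refine sum_congr rfl fun F hF => ?_
        have heven : Even #(oddVerts (Finset.insertNone S) F) := even_card_oddVerts (mem_powerset.1 hF)
        by_cases hq : oddVerts (Finset.insertNone S) F = starSet A
        · rw [if_pos hq, if_pos]
          rw [Finset.symmDiff_eq_empty, (eraseNone_eq_iff_eq_starSet heven A).2 hq]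
        · rw [if_neg hq, if_neg, mul_zero]
          intro h0
          exact hq ((eraseNone_eq_iff_eq_starSet heven A).1 (Finset.symmDiff_eq_empty.1 h0))
    _ = _ := by
        rw [mul_sum]
        exact sum_congr rfl fun F _ => by simp only [hc]; ring

/-- The `sinh/cosh` form versus the `tanh` form:
`∑_{∂F = B} (∏_F sinh θ)(∏_{E∖F} cosh θ) = (∏_E cosh θ) · g_E(B)`. [folklore] -/
theorem sum_sinh_cosh_eq_cosh_mul_ghteSum (θ : Sym2 (Option V) → ℝ) (Λ' : Finset (Option V))
    (E : Finset (Sym2 (Option V))) (B : Finset (Option V)) :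
    ∑ F ∈ E.powerset with oddVerts Λ' F = B, (∏ e ∈ F, Real.sinh (θ e)) * ∏ e ∈ E \ F, Real.cosh (θ e) =
      (∏ e ∈ E, Real.cosh (θ e)) * ghteSum Λ' θ E B := by
  rw [ghteSum, mul_sum]
  refine sum_congr rfl fun F hF => ?_
  have hFE : F ⊆ E := mem_powerset.1 (mem_filter.1 hF).1
  rw [← prod_sdiff hFE, mul_comm, mul_assoc, ← prod_mul_distrib]
  congr 1
  refine prod_congr rfl fun e _ => ?_
  rw [Real.tanh_eq_sinh_div_cosh, mul_div_cancel₀ _ (Real.cosh_pos _).ne']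

/-- **High-temperature expansion of correlations with field** (Duminil-Copin 2016, §2.2.1, last
display, with the ghost edges): for `S ⊆ Λ`, `A ⊆ S`,
`⟨σ_A⟩^∅_{S;β,h} = g_{ℰ⁺_S}(A*) / g_{ℰ⁺_S}(∅)` with `g_E(B) = ∑_{F ⊆ E, ∂F = B} ∏_F tanh θ_e`. [cite: DuminilCopinECM2018, §2.2.1 (high-temperature expansion)] -/
theorem isingCorr_free_field_eq_ghteSum_div {S : Finset V} (hS : S ⊆ Λ) (β h : ℝ) {A : Finset V}
    (hA : A ⊆ S) :
    isingCorr G S β h .free A =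
      ghteSum (Finset.insertNone S) (ghostCoupling β (β * h)) (edgesIn (ghostGraph G Λ) (Finset.insertNone S))
          (starSet A) /
        ghteSum (Finset.insertNone S) (ghostCoupling β (β * h)) (edgesIn (ghostGraph G Λ) (Finset.insertNone S)) ∅ := by
  have hZ : isingPartitionFunction G S β h .free =
      ∑ τ : S → ℤˣ, isingWeight G S β h .free τ * spinProduct ∅ (glue S τ .free) := by
    simp [isingPartitionFunction, spinProduct]
  rw [isingCorr, isingExpect, integral_isingMeasure G S β h .free (measurable_spinProduct A), hZ,
    boltzmannSum_free_field_eq hS β h hA, boltzmannSum_free_field_eq hS β h (empty_subset S),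
    sum_sinh_cosh_eq_cosh_mul_ghteSum, sum_sinh_cosh_eq_cosh_mul_ghteSum, starSet_empty]
  have hc : (Fintype.card (S → ℤˣ) : ℝ) *
      ∏ e ∈ edgesIn (ghostGraph G Λ) (Finset.insertNone S), Real.cosh (ghostCoupling β (β * h) e) ≠ 0 :=
    (mul_pos (Nat.cast_pos.2 Fintype.card_pos) (prod_pos fun e _ => Real.cosh_pos _)).ne'
  rw [← mul_assoc, ← mul_assoc, mul_div_mul_left _ _ hc]

/-! ### The random-current representation with field, eq. (2.2) -/

/-- Current sums on the ghost graph restricted to the edges inside `S ∪ {g}`, evaluated with the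
odd vertices computed in `S ∪ {g}`:
`Z_{ℰ⁺_S}(B) = (∏_{ℰ⁺_S} cosh θ) g_{ℰ⁺_S}(B)`. [cite: DuminilCopinECM2018, §3, Remark 3.4] -/
theorem gcurrentZ_ghost_eq {S : Finset V} (hS : S ⊆ Λ) {θ : Sym2 (Option V) → ℝ} (hθ : ∀ e, 0 ≤ θ e)
    {E : Finset (Sym2 (Option V))} (hE : E ⊆ edgesIn (ghostGraph G Λ) (Finset.insertNone S))
    (B : Finset (Option V)) :
    gcurrentZ (ghostGraph G Λ) (Finset.insertNone Λ) θ E B =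
      ENNReal.ofReal ((∏ e ∈ E, Real.cosh (θ e)) * ghteSum (Finset.insertNone S) θ E B) := by
  rw [gcurrentZ_eq_ofReal_ghteSum (ghostGraph G Λ) (Finset.insertNone Λ) hθ
    (hE.trans (edgesIn_insertNone_mono hS))]
  congr 2
  unfold ghteSum
  refine sum_congr ?_ fun _ _ => rfl
  ext F
  simp only [mem_filter, mem_powerset, and_congr_right_iff]
  intro hF
  rw [oddVerts_eq_of_subset (ghostGraph G Λ) (Finset.insertNone.monotone hS) (hF.trans hE)]

/-- `Z_{ℰ⁺_S}(B)` as a real number. [folklore] -/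
theorem toReal_gcurrentZ_ghost {S : Finset V} (hS : S ⊆ Λ) {θ : Sym2 (Option V) → ℝ} (hθ : ∀ e, 0 ≤ θ e)
    {E : Finset (Sym2 (Option V))} (hE : E ⊆ edgesIn (ghostGraph G Λ) (Finset.insertNone S))
    (B : Finset (Option V)) :
    (gcurrentZ (ghostGraph G Λ) (Finset.insertNone Λ) θ E B).toReal =
      (∏ e ∈ E, Real.cosh (θ e)) * ghteSum (Finset.insertNone S) θ E B := by
  rw [gcurrentZ_ghost_eq hS hθ hE, ENNReal.toReal_ofReal]
  exact mul_nonneg (prod_nonneg fun e _ => (Real.cosh_pos _).le) (ghteSum_nonneg hθ _ _)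

/-- **The random-current representation with a magnetic field, Duminil-Copin–Tassion 2016,
eq. (2.2)**: for `S ⊆ Λ`, `A ⊆ S`, `β ≥ 0`, `h ≥ 0`,
`⟨σ_A⟩^∅_{S;β,h} = ∑_{∂n = A*} w(n) / ∑_{∂n = ∅} w(n)`, the currents living on the edges of `G`
inside `S` and the ghost edges at `S` (couplings `β`, resp. `βh` in the tree's parametrisation of
the field), `A* = A` for `|A|` even and `A ∪ {g}` for `|A|` odd. [cite: DuminilCopinTassionCMP2016, §2.3, eq. (2.2) (arXiv:1502.03050 numbering)] -/
theorem isingCorr_free_eq_gcurrentZ_div {S : Finset V} (hS : S ⊆ Λ) {β h : ℝ} (hβ : 0 ≤ β) (hh : 0 ≤ h)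
    {A : Finset V} (hA : A ⊆ S) :
    isingCorr G S β h .free A =
      (gcurrentZ (ghostGraph G Λ) (Finset.insertNone Λ) (ghostCoupling β (β * h))
          (edgesIn (ghostGraph G Λ) (Finset.insertNone S)) (starSet A)).toReal /
        (gcurrentZ (ghostGraph G Λ) (Finset.insertNone Λ) (ghostCoupling β (β * h))
          (edgesIn (ghostGraph G Λ) (Finset.insertNone S)) ∅).toReal := by
  have hθ : ∀ e : Sym2 (Option V), 0 ≤ ghostCoupling β (β * h) e :=
    ghostCoupling_nonneg hβ (mul_nonneg hβ hh)
  rw [toReal_gcurrentZ_ghost hS hθ subset_rfl, toReal_gcurrentZ_ghost hS hθ subset_rfl,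
    isingCorr_free_field_eq_ghteSum_div hS β h hA,
    mul_div_mul_left _ _ (prod_pos fun e _ => Real.cosh_pos _).ne']

/-- **The random-current representation at zero field inside a sub-volume** (Duminil-Copin–
Tassion 2016, eq. (2.2) with `h = 0`, as used in Claim 2 of the proof of Lemma 2.6 for
`⟨σ₀σ_x⟩_{S,β,0}`): for `S ⊆ Λ`, `A ⊆ S` of even cardinality and `β ≥ 0`,
`⟨σ_A⟩^∅_{S;β,0} = Z_{ℰ_S}(A) / Z_{ℰ_S}(∅)` with the currents on the edges of `G` inside `S` only
(no ghost edges), whatever the coupling `k` carried by the ghost edges. [cite: DuminilCopinTassionCMP2016, §2.3, eq. (2.2), and proof of Lemma 2.6, Claim 2 (arXiv:1502.03050 numbering)] -/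
theorem isingCorr_free_zero_eq_gcurrentZ_div {S : Finset V} (hS : S ⊆ Λ) {β : ℝ} (hβ : 0 ≤ β)
    (k : ℝ) {A : Finset V} (hA : A ⊆ S) (hAe : Even #A) :
    isingCorr G S β 0 .free A =
      (gcurrentZ (ghostGraph G Λ) (Finset.insertNone Λ) (ghostCoupling β k)
          ((edgesIn G S).map liftEdge) (A.map Function.Embedding.some)).toReal /
        (gcurrentZ (ghostGraph G Λ) (Finset.insertNone Λ) (ghostCoupling β k)
          ((edgesIn G S).map liftEdge) ∅).toReal := by
  have h0 := isingCorr_free_eq_gcurrentZ_div (G := G) (Λ := Λ) hS hβ le_rfl hA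
  rw [mul_zero, starSet_of_even hAe] at h0
  rw [h0]
  -- remove the ghost edges (coupling `0`) and change their coupling to `k`
  have hrem : ∀ B : Finset (Option V),
      gcurrentZ (ghostGraph G Λ) (Finset.insertNone Λ) (ghostCoupling β 0)
          (edgesIn (ghostGraph G Λ) (Finset.insertNone S)) B =
        gcurrentZ (ghostGraph G Λ) (Finset.insertNone Λ) (ghostCoupling β k) ((edgesIn G S).map liftEdge) B := by
    intro B
    rw [gcurrentZ_eq_of_zero_off (map_liftEdge_subset_edgesIn hS)]
    · refine gcurrentZ_congr (fun e he => ?_) B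
      obtain ⟨e', -, rfl⟩ := mem_map.1 he
      rw [ghostCoupling_liftEdge, ghostCoupling_liftEdge]
    · intro e he hne
      rw [edgesIn_ghostGraph_insertNone hS, mem_union] at he
      rcases he with he | he
      · exact absurd he hne
      · obtain ⟨x, -, rfl⟩ := mem_map.1 he
        exact ghostCoupling_ghostEdge β 0 x
  rw [hrem, hrem]

/-- `Z_{ℰ⁺_S}(∅)` is positive and finite, as a real number. [folklore] -/
theorem toReal_gcurrentZ_ghost_empty_pos {S : Finset V} (hS : S ⊆ Λ) {θ : Sym2 (Option V) → ℝ}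
    (hθ : ∀ e, 0 ≤ θ e) {E : Finset (Sym2 (Option V))} (hE : E ⊆ edgesIn (ghostGraph G Λ) (Finset.insertNone S)) :
    0 < (gcurrentZ (ghostGraph G Λ) (Finset.insertNone Λ) θ E ∅).toReal := by
  refine ENNReal.toReal_pos (ne_of_gt (lt_of_lt_of_le zero_lt_one (one_le_gcurrentZ_empty θ E))) ?_
  exact gcurrentZ_ne_top hθ (hE.trans (edgesIn_insertNone_mono hS)) ∅

end Ghost

end Literature.Probability.LatticeModels
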